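import Literature.MathematicalPhysics.QuantumFieldTheory.BalabanImbrieJaffe1984to88.BIJ88LocHolder230FlatTorus
import Literature.MathematicalPhysics.QuantumFieldTheory.BalabanImbrieJaffe1984to88.BIJ88LocDeriv230ZetaPiFlatTorus
import Literature.MathematicalPhysics.QuantumFieldTheory.BalabanImbrieJaffe1984to88.BIJ88ConvexWeights227SecondDiff

/-!
# `BalabanImbrieJaffe1984to88.BIJ88LocDerivHolder230FlatTorus` — T. Bałaban, J. Imbrie, A. Jaffe, *Effective action and cluster properties
of the abelian Higgs model*, Commun. Math. Phys. **114** (1988) 257–315 [BalabanImbrieJaffe1988], Sect. 2 p. 263 [PDF 7], (2.27)–(2.30) and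
the sentence after (2.33): **THE HÖLDER MEMBER OF TOP ORDER `1 + θ` (`0 ≤ θ < 1`) OF (2.30) AT FLAT BACKGROUNDS** — the Hölder quotient of the
covariant derivative of `G_{k,loc}(1^h)f`, [6] (1.9) for the located propagator built from gen 26's torus cubes and weights of (2.27) and a
cut-off of (2.29) that is SMOOTH in the lattice point (r18's product form `ζ^Π(R₁, R₀)`; print: *"ζ_k(x₁, x₂) is a smooth function of
x₁ − x₂"*).  With gen 27 (`deriv230_flat_cwt`, order 1), gen 28's `BIJ88LocHolder230FlatTorus` (order `θ ≤ 1`) and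
`BIJ88LocDeriv230ZetaPiFlatTorus` (order 1 for `ζ^Π`), this is the last of the *"Holder derivatives of G_{k,loc}(u) of order less than two"*
at `u = 1^h`.

statement-level skeleton of published theorems with citation tags; proofs where landed; nothing here is a claim about the Yang–Mills mass gap

PDF held: `paper:balaban1988-cmp114-bij-abelian-higgs-effective-action` (journal page = PDF page + 256); p. 263 [PDF 7] re-read this session
(text layer); [6] = T. Bałaban, *Regularity and decay of lattice Green's functions*, Commun. Math. Phys. 89 (1983) [Balaban1983RegularityDecay],
(1.9) p. 573 through p38's `B4Thm19ZeroBoxHolder`.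

CITATION HEADER (lean-in-tree rule).  Part of the lit-balaban TYPED SKELETON (HOME `run/shared/lean/pub/lit-balaban/`), PHASE-2 proof seat
p29 gen 28 (unit `lit-balaban-p29-g28`; TAKING line HOME/STATUS.md 2026-08-22T22:01:27Z, file (3) of that line — second half; free-target
protocol G.5-34(d)).  Row **C2.Claim@263** p. 263 (*"Bounds analogous to (2.30), (2.31) hold for covariant derivatives and Hölder derivatives
of G_{k,loc}(u) of order less than two"*; head = p08's abstract hence-step `BIJ88HolderDecay230`, unchanged; owner r18).  Kind: theorems only
(no definition, no `Prop`-valued fact; p38's / p31's / p13's / r18's / gen 26–28's declarations used BY NAME).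

THE PRINTED TEXT (verbatim, p. 263; v1.1: the display (2.29) re-read on the page render `lit-balaban-p31/renders/original-p007-x2.png` and
quoted as printed — v1.0 had put [6]'s profile radii `1/3`, `2/3` of p. 575 here, the owner's second-read note D-r18-g23-1).  *"G̃_k(u; x₁, x₂) =
Σ_α λ_αG_k(□_α, u; x₁, x₂), (2.27) … G_{k,loc}(u; x₁, x₂) = ζ″_k(x₁, x₂)G̃_k(u; x₁, x₂), (2.28) where ζ″_k(x₁, x₂) is a smooth function of x₁ − x₂,
ζ″_k(x₁, x₂) = 0, if |x₁ − x₂| ≧ (1/(4L)) r(e_{k−1}); 1, if |x₁ − x₂| ≦ (1/(8L)) r(e_{k−1}). (2.29) … |(G_{k,loc}(u)f)(x)| ≦ ce^{−c dist(suppt f,x)}‖f‖_∞,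
(2.30) … Bounds analogous to (2.30), (2.31) hold for covariant derivatives and Hölder derivatives of G_{k,loc}(u) of order less than two."*  (The
statements below carry the two radii as free parameters `R₁ < R₀` — `ζ″ = 1` within `R₁`, `ζ″ = 0` beyond `R₀` in the sup torus distance — so the
printed assignment `R₁ = (1/(8L))r(e_{k−1})·L^k`, `R₀ = (1/(4L))r(e_{k−1})·L^k` fine bonds is one admissible choice; no declaration is affected by
this correction.)  [6] (1.9) p. 573: *"For α < 1 there exist positive constants δ₀, c₀ …
|x − x′|^{−α}|U(A(Γ_{x,x′}))(D^η_{A,μ}G_k(Ω, A)f)(x′) − (D^η_{A,μ}G_k(Ω, A)f)(x)| ≤ c₀exp(−δ₀ dist({x, x′}, supp f))‖f‖_∞"*.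

WHAT IS PROVED (theorems only; 0 `sorry`; standard axioms).
* §1 **`holder19_flat_cube_level`** — [6] (1.9) for the cube propagators `G_k(□, 1^h)` of record in level-`k` units
  (`≤ (L^kε)·c₀e^{−δ₀D/L^k}F`; p31's `holder19_flat_cube` re-derived from p38's box theorem keeping the printed scale and exponent).
* §2 the coordinate hull of two chart points (private plumbing) and the row weights `w_α(x, y) = ζ″(x, y)λ_α(x, y)` along it:
  `abs_weight_secondDiff_le` (mixed second lattice differences in `x` `≤ K₂ + 4π²/s² + 2K₁·3π(d+1)/(2s)` for any cut-off with moduli `K₁`,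
  `K₂`, by the discrete product rule and `BIJ88ConvexWeights227SecondDiff.abs_cwt_secondDiff_le`), `abs_weight_shift_sub_le_of_hull`,
  `abs_weight_bondDiff_sub_le_of_hull` (first differences and bond differences of `w_α` between two chart points, `ℓ¹`-Lipschitz along a
  staircase in the hull, gen 28's `norm_sub_le_mul_l1_of_bond_bound`).
* §3 `norm_rot_sub_le_of_covD_le` — the gauge-covariant telescoping `‖h(z₂)⁻¹ψ(z₂) − h(z₁)⁻¹ψ(z₁)‖ ≤ ε·B·|z₂ − z₁|₁` from a bond-wise
  bound `‖(D_uψ)(b)‖ ≤ B` on the hull.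
* §4 **`derivHolder230_flat_of_smooth`** — THERE EXIST `δ₀, c₀ > 0` from `(d, ℓ, a, θ, K₁, K₂)` such that for every volume, `1 ≤ k ≤ K`,
  no-wrap box `Ω₀` shorter than HALF the torus with torus gap `≥ R > L^k + 2`, `s ≥ 1`, `W ≥ 2s/3 + R₀/2 + R`, `0 ≤ R₁ < R₀`, `L^k ≤ R₀`,
  EVERY cut-off `ζ″` (`|ζ″| ≤ 1`, `= 0` beyond `R₀`, first/second lattice differences `≤ K₁/(R₀−R₁)`, `K₂/(R₀−R₁)²`), every pure gauge `h`,
  two bonds `⟨x_i, x_i + e_μ⟩` with all four end points in `Ω₀` at chart depth `≥ R₀`, every `f` (`‖f‖_∞ ≤ F`) supported at distance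
  `≥ D` from `x₁`, `x₂`:
  `(L^k/|x₁−x₂|_T)^θ·‖h(x₁)h(x₂)⁻¹(D_uG_{k,loc}(1^h)f)(x₂,μ) − (D_uG_{k,loc}(1^h)f)(x₁,μ)‖ ≤ (L^kε)·c₀·m·(1 + L^k((R₀−R₁)⁻¹ + s⁻¹))²·e^{−δ₀D/L^k}·F`,
  `m = (⌊(L^k − 1 + R₀)/s⌋ + 3)^{d+1}`.  Mechanism: the bond identity (gen 27 `covD_gLocT_apply`) at both bonds and a four-term split —
  [6] (1.9) per active cube on a fixed row source, [6] (1.10) on the difference of row sources, the transported difference of VALUES of the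
  cube propagators on the bond-difference source telescoped along the hull with (1.10) per bond, and (1.10)'s value member on the SECOND
  difference of the row weights; far pairs (`|x₁ − x₂|_T > L^k`) by two derivative members (`deriv230_flat_of_lipschitz`).
* §5 **`derivHolder230_flat_zetaPi`** — the same for `ζ″ = ζ^Π(R₁, R₀)` (`1 ≤ R₁ < R₀ ≤ (|T^{(0)}| − 3)/2`), constants from `(d, ℓ, a, θ)`
  and the tree's universal bound `C_σ` on `|σ′|`, `|σ″|`.
HONEST SCOPE.  (i) FLAT / PURE-GAUGE BACKGROUNDS ONLY (`u = 1^h`), as all located members of gens 26–28.  (ii) The cut-off must be smooth IN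
THE LATTICE POINT (second differences `O((R₀−R₁)⁻²)`): p13's cut-off of record `σ((R₀ − |x−y|_T)/(R₀−R₁))` (sup-norm torus distance inside
the profile) is only Lipschitz in `x` and is NOT covered by §4; r18's product form `ζ^Π` is (§5) — both satisfy the printed (2.29).  (iii) Extra
hypotheses relative to gen 27's derivative member: the box shorter than HALF the torus (so that torus and chart distances of its points agree,
[6]'s rectangular-parallelepiped clause), `R > L^k + 2` and `R₀ ≥ L^k` (near pairs and their bonds lie in one active cube and are chart-close),
all four bond end points at chart depth `≥ R₀`; the bracket `(1 + L^k((R₀−R₁)⁻¹ + s⁻¹))` of gen 27 appears SQUARED (second differences of the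
weights).  (iv) Constants explicit but not optimized; `C_σ` non-explicit (compactness).  (v) `set_option maxHeartbeats 800000` on §4's theorem
(elaboration budget only).  Imports: gen 28's `BIJ88LocHolder230FlatTorus` (telescoping, transport identities; → gen 27, gen 26, p31, p13),
`BIJ88LocDeriv230ZetaPiFlatTorus` (generic derivative member, `ζ^Π` at scale 0; → r18), `BIJ88ConvexWeights227SecondDiff` (C^{1,1} weights).
Literature + Mathlib only.  Unit `lit-balaban-p29` (literature-prover-lit-balaban-p29-g28-0), 2026-08-22; v1.1 = DOCSTRING-ONLY correction of the
(2.29) quotation above (unit `lit-balaban-p29-g29`, literature-prover-lit-balaban-p29-g29-0, 2026-08-23; every declaration byte-identical to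
v1.0 = p344675).  NOT summit progress.
-/


open scoped BigOperators Matrix ComplexConjugate
open Finset Matrix Set

namespace Literature.MathematicalPhysics.QuantumFieldTheory.BalabanImbrieJaffe1984to88.BIJ88LocDerivHolder230FlatTorus

open Literature.MathematicalPhysics.QuantumFieldTheory.Balaban1983to89
open BIJ88Sect3Statements (U1 toC cfg covD toC_mul toC_one norm_toC)
open BIJ85BlockAveragesTorus BIJ85BlockAveragesTorusK
open BIJ88NeumannPropagator227Torus (gBox)
open BIJ88DeltaLoc234Torus (gLocT)
open BIJ88NeumannPropagatorFlatDecay (norm_rot)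
open BIJ88NeumannPropagatorFlatDecayCube
open BIJ88NeumannPropagatorFlatClose231 (norm_rowSource_le rowSource_ne_zero abs_lam_le_one fit_of_nested short_of_nested)
open BIJ88DeltaLocFlatClose235 (decay110_flat_cube_level decay110_flat_cube_deriv_level)
open BIJ88ConvexWeights227 (cwt cwt_le_one)
open BIJ88ConvexWeights227SecondDiff (abs_cwt_secondDiff_le)
open BIJ88LocWeights227Torus
open BIJ88LocDeriv230FlatTorus (T_shift_le_one abs_lamT_shift_sub_le covD_gLocT_apply)
open BIJ88LocHolder230FlatTorus (norm_sub_le_mul_l1_of_bond_bound norm_rot_tgt_sub_rot_src norm_transport_sub)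
open BIJ88LocDeriv230ZetaPiFlatTorus (abs_weight_shift_sub_le norm_rowSource_sub_le_of_lipschitz deriv230_flat_of_lipschitz
  zetaPi_zero_eq_zero_of_le abs_zetaPi_zero_le_one abs_zetaPi_zero_shift_sub_le abs_zetaPi_zero_secondDiff_le)
open BIJ88HkLocHolderTorus (zetaPi secondDiffConst)
open B4Reflection242 (boxDom mem_boxDom)
open B4ContourShift (supNorm abs_le_supNorm supNorm_nonneg exists_supNorm_eq)
open B4BoxCov237 (boxOpR)
open GaugeField (gaugeAct)
open Literature.Analysis.Calculus (exists_abs_deriv_and_deriv_deriv_smoothTransition_le)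

noncomputable section

variable {d : ℕ} {P : Params}


/-! ## §1 [6] (1.9), the Hölder member, for the cube propagators at `u = 1^h`, IN LEVEL-`k` UNITS -/

section HolderLevel

/-- kernel: the real part of a real matrix applied to a complex vector. [folklore] -/
private theorem re_map_mulVec₃ {m q : Type*} [Fintype q] (G : Matrix m q ℝ) (g : q → ℂ) (x : m) :
    ((G.map Complex.ofRealHom *ᵥ g) x).re = (G *ᵥ fun y => (g y).re) x := by
  simp only [mulVec, dotProduct, map_apply, Complex.ofRealHom_eq_coe, Complex.re_sum, Complex.re_ofReal_mul]

/-- kernel: the same for the imaginary part. [folklore] -/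
private theorem im_map_mulVec₃ {m q : Type*} [Fintype q] (G : Matrix m q ℝ) (g : q → ℂ) (x : m) :
    ((G.map Complex.ofRealHom *ᵥ g) x).im = (G *ᵥ fun y => (g y).im) x := by
  simp only [mulVec, dotProduct, map_apply, Complex.ofRealHom_eq_coe, Complex.im_sum, Complex.im_ofReal_mul]

/-- kernel: `‖z − w‖ ≤ |Re z − Re w| + |Im z − Im w|`. [folklore] -/
private theorem norm_sub_le_re_im₃ (z w : ℂ) : ‖z - w‖ ≤ |z.re - w.re| + |z.im - w.im| := by
  have h := Complex.norm_le_abs_re_add_abs_im (z - w)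
  rwa [Complex.sub_re, Complex.sub_im] at h

/-- **[6] (1.9), THE HÖLDER MEMBER, FOR THE CUBE PROPAGATORS OF RECORD AT EVERY PURE-GAUGE BACKGROUND, IN LEVEL-`k` UNITS** (p31's
`holder19_flat_cube` with the printed scale and exponent kept: *"|x − x′|^{−α}|U(A(Γ_{x,x′}))(D^η_{A,μ}G_k(Ω, A)f)(x′) − (D^η_{A,μ}G_k(Ω, A)f)(x)| ≤
c₀exp(−δ₀ dist({x, x′}, supp f))‖f‖_∞ (1.9)"*, p. 573): for every `0 ≤ α < 1` there are `δ₀, c₀ > 0` depending on `(d, ℓ, a, α)` only such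
that for every cube `c·L^k + Π_i[0, L^kM_i)` shorter than HALF the torus, every pure gauge `h`, every direction `μ`, all pairs of bonds
`⟨x₁,x₁+e_μ⟩`, `⟨x₂,x₂+e_μ⟩` of the cube with `x₁ ≠ x₂` and every `f` (`‖f‖_∞ ≤ F`) supported at sup-torus distance `≥ D` from `x₁` and `x₂`:
`(L^k/|x₁−x₂|_T)^α·‖h(x₁)h(x₂)⁻¹(D_uG f)(x₂,μ) − (D_uG f)(x₁,μ)‖ ≤ (L^kε)·c₀e^{−δ₀D/L^k}F` — from p38's zero-field box theorem
`B4Thm19ZeroBoxHolder.thm19_zero_box_holder_value` on the real and imaginary parts of `h̄f` read in the box, exactly as p31.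
[cite: Balaban1983RegularityDecay, (1.9) p.573] -/
theorem holder19_flat_cube_level (d ℓ : ℕ) (hℓ : 1 ≤ ℓ) {a : ℝ} (ha : 0 < a) {α : ℝ} (hα0 : 0 ≤ α) (hα1 : α < 1) :
    ∃ δ₀ c₀ : ℝ, 0 < δ₀ ∧ 0 < c₀ ∧ ∀ (P : Params) (hPd : P.d = d + 1), P.L = ℓ + 1 →
      ∀ k : ℕ, 1 ≤ k → k ≤ P.K → ∀ (c M : Fin (d + 1) → ℕ), (∀ i, 1 ≤ M i) →
        (∀ i, c i * P.L ^ k + P.L ^ k * M i ≤ P.sitesPerDir 0) → (∀ i, 2 * (P.L ^ k * M i) ≤ P.sitesPerDir 0) →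
        ∀ (h : GaugeTransf P 0 U1) (μ : Fin P.d) (x₁ x₂ : Balaban1983to89.Site P 0), x₂ ≠ x₁ →
          x₁ ∈ cubeT hPd (P.L ^ k) c (fun i => P.L ^ k * M i) → x₁.shift μ ∈ cubeT hPd (P.L ^ k) c (fun i => P.L ^ k * M i) →
          x₂ ∈ cubeT hPd (P.L ^ k) c (fun i => P.L ^ k * M i) → x₂.shift μ ∈ cubeT hPd (P.L ^ k) c (fun i => P.L ^ k * M i) →
        ∀ (f : Balaban1983to89.Site P 0 → ℂ) (F D : ℝ), (∀ z, ‖f z‖ ≤ F) →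
          (∀ z, f z ≠ 0 → D ≤ B5Ineq137Torus.T P 0 x₁ z) → (∀ z, f z ≠ 0 → D ≤ B5Ineq137Torus.T P 0 x₂ z) →
            ((P.L : ℝ) ^ k / B5Ineq137Torus.T P 0 x₁ x₂) ^ α *
              ‖toC (h x₁) * (toC (h x₂))⁻¹ *
                  covD P.eps⁻¹ (cfg (gaugeAct h (1 : GaugeField P 0 U1)))
                    (gBox (B1RG242Torus.α P a k * (P.L : ℝ) ^ (k * P.d)) P.eps⁻¹ (gaugeAct h (1 : GaugeField P 0 U1)) k
                      (cubeT hPd (P.L ^ k) c fun i => P.L ^ k * M i) *ᵥ f) ⟨x₂, μ⟩ -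
                covD P.eps⁻¹ (cfg (gaugeAct h (1 : GaugeField P 0 U1)))
                    (gBox (B1RG242Torus.α P a k * (P.L : ℝ) ^ (k * P.d)) P.eps⁻¹ (gaugeAct h (1 : GaugeField P 0 U1)) k
                      (cubeT hPd (P.L ^ k) c fun i => P.L ^ k * M i) *ᵥ f) ⟨x₁, μ⟩‖
              ≤ P.spacing k * (c₀ * Real.exp (-(δ₀ * (((P.L : ℝ) ^ k)⁻¹ * D))) * F) := by
  obtain ⟨δ₀, c₀, hδ₀, hc₀, H⟩ := B4Thm19ZeroBoxHolder.thm19_zero_box_holder_value d ℓ hℓ a a 0 ha α hα0 hα1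
  refine ⟨δ₀, 2 * c₀, hδ₀, by positivity, ?_⟩
  intro P hPd hPL k hk1 hkK c M hM hfit hhalf h μ x₁ x₂ hne hx₁ hx₁e hx₂ hx₂e f F D hF hs₁ hs₂
  have hk : k ≤ P.m + P.K := hkK.trans (Nat.le_add_left _ _)
  have e1 : P.L ^ k = (ℓ + 1) ^ k := by rw [hPL]
  rw [e1] at hfit hhalf hx₁ hx₁e hx₂ hx₂e ⊢
  have hn : (ℓ + 1) ^ k = P.L ^ k := e1.symm
  have hN : ∀ i, (ℓ + 1) ^ k * M i < P.sitesPerDir 0 := fun i => by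
    have := hhalf i; have := hM i; have : 1 ≤ (ℓ + 1) ^ k * M i := Nat.one_le_iff_ne_zero.2 (by positivity); omega
  have hF0 : 0 ≤ F := (norm_nonneg _).trans (hF x₁)
  have hncast : (((ℓ + 1) ^ k : ℕ) : ℝ) = (P.L : ℝ) ^ k := by rw [hn]; push_cast; rfl
  have hnpos : (0 : ℝ) < (((ℓ + 1) ^ k : ℕ) : ℝ) := by positivity
  -- the exponent of [6] in level-`k` units: `D/(ℓ+1)^k = D/L^k`
  have hconv : ∀ E : ℝ, Real.exp (-(δ₀ * E / ((((ℓ + 1) ^ k : ℕ) : ℝ)))) = Real.exp (-(δ₀ * (((P.L : ℝ) ^ k)⁻¹ * E))) := fun E => by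
    congr 1
    rw [hncast, div_eq_mul_inv]
    ring
  have hscale : P.eps⁻¹ * P.spacing k ^ 2 = P.spacing k * (((ℓ + 1) ^ k : ℕ) : ℝ) := by
    rw [hncast, Params.spacing]
    have hε : P.eps ≠ 0 := P.eps_pos.ne'
    field_simp
  have hLcast : ((ℓ : ℝ) + 1) = (P.L : ℝ) := by rw [hPL]; push_cast; ring
  have H' := H k hk1 a 0 le_rfl le_rfl le_rfl le_rfl M hM
  rw [hLcast] at H'
  -- the four points in the box
  obtain ⟨z₁, hz₁, rfl⟩ := (mem_cubeT hPd).1 hx₁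
  obtain ⟨z₂, hz₂, rfl⟩ := (mem_cubeT hPd).1 hx₂
  have hz₁e : z₁ + Pi.single (Fin.cast hPd μ) 1 ∈ boxDom (fun i => (ℓ + 1) ^ k * M i) := (shift_cubePt_mem_iff hPd hN hz₁ μ).1 hx₁e
  have hz₂e : z₂ + Pi.single (Fin.cast hPd μ) 1 ∈ boxDom (fun i => (ℓ + 1) ^ k * M i) := (shift_cubePt_mem_iff hPd hN hz₂ μ).1 hx₂e
  have hshift : ∀ z : Fin (d + 1) → ℤ,
      (cubePt hPd ((ℓ + 1) ^ k) c z).shift μ = cubePt hPd ((ℓ + 1) ^ k) c (z + Pi.single (Fin.cast hPd μ) 1) := fun z => by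
    rw [cubePt_add_single]
    congr 1
  have hzne : z₂ ≠ z₁ := fun e => hne (by rw [e])
  -- the weight: torus distance = box distance for a cube shorter than half the torus
  have hT : B5Ineq137Torus.T P 0 (cubePt hPd ((ℓ + 1) ^ k) c z₁) (cubePt hPd ((ℓ + 1) ^ k) c z₂) = supNorm (z₂ - z₁) := by
    rw [B5Ineq137Torus.T_symm, T_cubePt_eq hPd hfit hhalf hz₂ hz₁]
  have hW : ((P.L : ℝ) ^ k / B5Ineq137Torus.T P 0 (cubePt hPd ((ℓ + 1) ^ k) c z₁) (cubePt hPd ((ℓ + 1) ^ k) c z₂)) ^ α =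
      ((((ℓ + 1) ^ k : ℕ) : ℝ) / supNorm (z₂ - z₁)) ^ α := by rw [hT, hncast]
  have hW0 : 0 ≤ ((((ℓ + 1) ^ k : ℕ) : ℝ) / supNorm (z₂ - z₁)) ^ α :=
    Real.rpow_nonneg (div_nonneg (Nat.cast_nonneg _) (supNorm_nonneg _)) α
  rw [hW]
  -- the real estimate for a real source `φ` supported like `f`
  have key : ∀ φ : Balaban1983to89.Site P 0 → ℝ, (∀ y, |φ y| ≤ F) →
      (∀ y, φ y ≠ 0 → D ≤ B5Ineq137Torus.T P 0 (cubePt hPd ((ℓ + 1) ^ k) c z₁) y) →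
      (∀ y, φ y ≠ 0 → D ≤ B5Ineq137Torus.T P 0 (cubePt hPd ((ℓ + 1) ^ k) c z₂) y) →
      ((((ℓ + 1) ^ k : ℕ) : ℝ) / supNorm (z₂ - z₁)) ^ α *
        |P.eps⁻¹ * ((gCubeR hPd ((ℓ + 1) ^ k) c M (P.spacing k ^ 2) (B1.aSeq a P.L k) *ᵥ φ)
              (cubePt hPd ((ℓ + 1) ^ k) c (z₂ + Pi.single (Fin.cast hPd μ) 1)) -
            (gCubeR hPd ((ℓ + 1) ^ k) c M (P.spacing k ^ 2) (B1.aSeq a P.L k) *ᵥ φ) (cubePt hPd ((ℓ + 1) ^ k) c z₂)) -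
          P.eps⁻¹ * ((gCubeR hPd ((ℓ + 1) ^ k) c M (P.spacing k ^ 2) (B1.aSeq a P.L k) *ᵥ φ)
              (cubePt hPd ((ℓ + 1) ^ k) c (z₁ + Pi.single (Fin.cast hPd μ) 1)) -
            (gCubeR hPd ((ℓ + 1) ^ k) c M (P.spacing k ^ 2) (B1.aSeq a P.L k) *ᵥ φ) (cubePt hPd ((ℓ + 1) ^ k) c z₁))| ≤
        P.spacing k * (c₀ * Real.exp (-(δ₀ * (((P.L : ℝ) ^ k)⁻¹ * D))) * F) := by
    intro φ hφ hφ₁ hφ₂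
    rw [gCubeR_mulVec_cubePt hPd hfit _ _ φ hz₂e, gCubeR_mulVec_cubePt hPd hfit _ _ φ hz₂, gCubeR_mulVec_cubePt hPd hfit _ _ φ hz₁e,
      gCubeR_mulVec_cubePt hPd hfit _ _ φ hz₁]
    have halg : ∀ A B C E : ℝ, P.eps⁻¹ * (P.spacing k ^ 2 * A - P.spacing k ^ 2 * B) - P.eps⁻¹ * (P.spacing k ^ 2 * C - P.spacing k ^ 2 * E) =
        P.spacing k * ((((ℓ + 1) ^ k : ℕ) : ℝ) * ((A - B) - (C - E))) := fun A B C E => by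
      rw [← mul_assoc (P.spacing k), ← hscale]; ring
    rw [halg, abs_mul, abs_of_pos (P.spacing_pos k), mul_left_comm]
    have hB := H' (fun v => φ (cubePt hPd ((ℓ + 1) ^ k) c (v : Fin (d + 1) → ℤ))) F D (fun v => hφ _) (Fin.cast hPd μ)
      ⟨z₁, hz₁⟩ ⟨z₁ + Pi.single (Fin.cast hPd μ) 1, hz₁e⟩ ⟨z₂, hz₂⟩ ⟨z₂ + Pi.single (Fin.cast hPd μ) 1, hz₂e⟩ rfl rfl hzne
      (fun v hv => le_min ((hφ₁ _ hv).trans (T_cubePt_le hPd hfit hz₁ v.2)) ((hφ₂ _ hv).trans (T_cubePt_le hPd hfit hz₂ v.2)))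
    rw [hconv D] at hB
    exact mul_le_mul_of_nonneg_left hB (P.spacing_pos k).le
  -- remove the phases, split `h̄f` into real and imaginary parts
  set g : Balaban1983to89.Site P 0 → ℂ := fun y => (starRingEnd ℂ) (toC (h y)) * f y with hg
  have hgR : ∀ y, |(g y).re| ≤ F := fun y => ((Complex.abs_re_le_norm _).trans_eq (norm_rot h f y)).trans (hF y)
  have hgI : ∀ y, |(g y).im| ≤ F := fun y => ((Complex.abs_im_le_norm _).trans_eq (norm_rot h f y)).trans (hF y)
  have hgne : ∀ y, ((g y).re ≠ 0 ∨ (g y).im ≠ 0) → f y ≠ 0 := fun y hy hf => by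
    rcases hy with hy | hy
    · exact hy (by simp only [hg, hf, mul_zero, Complex.zero_re])
    · exact hy (by simp only [hg, hf, mul_zero, Complex.zero_im])
  set ψ : Balaban1983to89.Site P 0 → ℂ :=
    (gCubeR hPd ((ℓ + 1) ^ k) c M (P.spacing k ^ 2) (B1.aSeq a P.L k)).map Complex.ofRealHom *ᵥ g with hψ
  set δψ : Balaban1983to89.Site P 0 → ℂ := fun x => ((P.eps⁻¹ : ℝ) : ℂ) * (ψ (x.shift μ) - ψ x) with hδψ
  have hcov : ∀ x : Balaban1983to89.Site P 0, covD P.eps⁻¹ (cfg (gaugeAct h (1 : GaugeField P 0 U1)))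
      (gBox (B1RG242Torus.α P a k * (P.L : ℝ) ^ (k * P.d)) P.eps⁻¹ (gaugeAct h (1 : GaugeField P 0 U1)) k
        (cubeT hPd ((ℓ + 1) ^ k) c fun i => (ℓ + 1) ^ k * M i) *ᵥ f) ⟨x, μ⟩ = toC (h x) * δψ x := fun x => by
    rw [covD_gBox_cube_pureGauge hPd hk1 hk hn hfit hN hM ha]; rfl
  have hphase : toC (h (cubePt hPd ((ℓ + 1) ^ k) c z₁)) * (toC (h (cubePt hPd ((ℓ + 1) ^ k) c z₂)))⁻¹ *
        (toC (h (cubePt hPd ((ℓ + 1) ^ k) c z₂)) * δψ (cubePt hPd ((ℓ + 1) ^ k) c z₂)) -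
      toC (h (cubePt hPd ((ℓ + 1) ^ k) c z₁)) * δψ (cubePt hPd ((ℓ + 1) ^ k) c z₁) =
      toC (h (cubePt hPd ((ℓ + 1) ^ k) c z₁)) * (δψ (cubePt hPd ((ℓ + 1) ^ k) c z₂) - δψ (cubePt hPd ((ℓ + 1) ^ k) c z₁)) := by
    have hx₂' : toC (h (cubePt hPd ((ℓ + 1) ^ k) c z₂)) ≠ 0 := toC_ne_zero _
    field_simp
  rw [hcov, hcov, hphase, norm_mul, norm_toC, one_mul]
  have hre : ∀ z : Fin (d + 1) → ℤ, (δψ (cubePt hPd ((ℓ + 1) ^ k) c z)).re =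
      P.eps⁻¹ * ((gCubeR hPd ((ℓ + 1) ^ k) c M (P.spacing k ^ 2) (B1.aSeq a P.L k) *ᵥ fun y => (g y).re)
          (cubePt hPd ((ℓ + 1) ^ k) c (z + Pi.single (Fin.cast hPd μ) 1)) -
        (gCubeR hPd ((ℓ + 1) ^ k) c M (P.spacing k ^ 2) (B1.aSeq a P.L k) *ᵥ fun y => (g y).re) (cubePt hPd ((ℓ + 1) ^ k) c z)) :=
    fun z => by simp only [hδψ, hshift z, Complex.re_ofReal_mul, Complex.sub_re, hψ, re_map_mulVec₃]
  have him : ∀ z : Fin (d + 1) → ℤ, (δψ (cubePt hPd ((ℓ + 1) ^ k) c z)).im =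
      P.eps⁻¹ * ((gCubeR hPd ((ℓ + 1) ^ k) c M (P.spacing k ^ 2) (B1.aSeq a P.L k) *ᵥ fun y => (g y).im)
          (cubePt hPd ((ℓ + 1) ^ k) c (z + Pi.single (Fin.cast hPd μ) 1)) -
        (gCubeR hPd ((ℓ + 1) ^ k) c M (P.spacing k ^ 2) (B1.aSeq a P.L k) *ᵥ fun y => (g y).im) (cubePt hPd ((ℓ + 1) ^ k) c z)) :=
    fun z => by simp only [hδψ, hshift z, Complex.im_ofReal_mul, Complex.sub_im, hψ, im_map_mulVec₃]
  have E2 : P.spacing k * (2 * c₀ * Real.exp (-(δ₀ * (((P.L : ℝ) ^ k)⁻¹ * D))) * F) =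
      P.spacing k * (c₀ * Real.exp (-(δ₀ * (((P.L : ℝ) ^ k)⁻¹ * D))) * F) +
        P.spacing k * (c₀ * Real.exp (-(δ₀ * (((P.L : ℝ) ^ k)⁻¹ * D))) * F) := by ring
  calc ((((ℓ + 1) ^ k : ℕ) : ℝ) / supNorm (z₂ - z₁)) ^ α * ‖δψ (cubePt hPd ((ℓ + 1) ^ k) c z₂) - δψ (cubePt hPd ((ℓ + 1) ^ k) c z₁)‖
      ≤ ((((ℓ + 1) ^ k : ℕ) : ℝ) / supNorm (z₂ - z₁)) ^ α *
          (|(δψ (cubePt hPd ((ℓ + 1) ^ k) c z₂)).re - (δψ (cubePt hPd ((ℓ + 1) ^ k) c z₁)).re| +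
            |(δψ (cubePt hPd ((ℓ + 1) ^ k) c z₂)).im - (δψ (cubePt hPd ((ℓ + 1) ^ k) c z₁)).im|) :=
        mul_le_mul_of_nonneg_left (norm_sub_le_re_im₃ _ _) hW0
    _ = ((((ℓ + 1) ^ k : ℕ) : ℝ) / supNorm (z₂ - z₁)) ^ α *
            |(δψ (cubePt hPd ((ℓ + 1) ^ k) c z₂)).re - (δψ (cubePt hPd ((ℓ + 1) ^ k) c z₁)).re| +
          ((((ℓ + 1) ^ k : ℕ) : ℝ) / supNorm (z₂ - z₁)) ^ α *
            |(δψ (cubePt hPd ((ℓ + 1) ^ k) c z₂)).im - (δψ (cubePt hPd ((ℓ + 1) ^ k) c z₁)).im| := mul_add _ _ _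
    _ ≤ P.spacing k * (c₀ * Real.exp (-(δ₀ * (((P.L : ℝ) ^ k)⁻¹ * D))) * F) +
          P.spacing k * (c₀ * Real.exp (-(δ₀ * (((P.L : ℝ) ^ k)⁻¹ * D))) * F) := by
        rw [hre, hre, him, him]
        exact add_le_add
          (key _ hgR (fun y hy => hs₁ y (hgne y (Or.inl hy))) (fun y hy => hs₂ y (hgne y (Or.inl hy))))
          (key _ hgI (fun y hy => hs₁ y (hgne y (Or.inr hy))) (fun y hy => hs₂ y (hgne y (Or.inr hy))))
    _ = P.spacing k * (2 * c₀ * Real.exp (-(δ₀ * (((P.L : ℝ) ^ k)⁻¹ * D))) * F) := E2.symm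

end HolderLevel

/-! ## §2 The coordinate hull of two chart points; first and second differences of the row weights `w_α = ζ″λ_α` along it -/

section Hull

variable {N : Fin (d + 1) → ℕ} {z₁ z₂ : Fin (d + 1) → ℤ}

/-- kernel: the coordinate hull of two box points lies in the box. [folklore] -/
private theorem hull_mem_boxDom (hz₁ : z₁ ∈ boxDom N) (hz₂ : z₂ ∈ boxDom N) {z : Fin (d + 1) → ℤ}
    (hz : ∀ j, min (z₁ j) (z₂ j) ≤ z j ∧ z j ≤ max (z₁ j) (z₂ j)) : z ∈ boxDom N := by
  rw [mem_boxDom] at hz₁ hz₂ ⊢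
  intro i
  have h1 := hz₁ i; have h2 := hz₂ i; have h3 := hz i
  constructor <;> omega

/-- kernel: … and so does its unit shift in any direction when both end points leave one row of room. [folklore] -/
private theorem hull_add_single_mem_boxDom (hz₁ : z₁ ∈ boxDom N) (hz₂ : z₂ ∈ boxDom N) (hroom₁ : ∀ j, z₁ j + 1 < N j)
    (hroom₂ : ∀ j, z₂ j + 1 < N j) {z : Fin (d + 1) → ℤ} (hz : ∀ j, min (z₁ j) (z₂ j) ≤ z j ∧ z j ≤ max (z₁ j) (z₂ j))
    (m : Fin (d + 1)) : z + Pi.single m 1 ∈ boxDom N := by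
  rw [mem_boxDom] at hz₁ hz₂ ⊢
  intro i
  have h1 := hz₁ i; have h2 := hz₂ i; have h3 := hz i; have h4 := hroom₁ i; have h5 := hroom₂ i
  by_cases him : i = m
  · subst him; rw [Pi.add_apply, Pi.single_eq_same]; constructor <;> omega
  · rw [Pi.add_apply, Pi.single_eq_of_ne him, add_zero]; constructor <;> omega

/-- kernel: a unit step inside the hull stays in the hull. [folklore] -/
private theorem hull_add_single {z : Fin (d + 1) → ℤ} (hz : ∀ j, min (z₁ j) (z₂ j) ≤ z j ∧ z j ≤ max (z₁ j) (z₂ j)) {i : Fin (d + 1)}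
    (hi : z i + 1 ≤ max (z₁ i) (z₂ i)) :
    ∀ j, min (z₁ j) (z₂ j) ≤ (z + Pi.single i 1 : Fin (d + 1) → ℤ) j ∧ (z + Pi.single i 1 : Fin (d + 1) → ℤ) j ≤ max (z₁ j) (z₂ j) := by
  intro j
  by_cases hji : j = i
  · subst hji; rw [Pi.add_apply, Pi.single_eq_same]; have := hz j; constructor <;> omega
  · rw [Pi.add_apply, Pi.single_eq_of_ne hji, add_zero]; exact hz j

/-- kernel: hull points are coordinatewise no farther from either end point than the end points are from each other. [folklore] -/
private theorem abs_sub_le_of_hull {z : Fin (d + 1) → ℤ} (hz : ∀ j, min (z₁ j) (z₂ j) ≤ z j ∧ z j ≤ max (z₁ j) (z₂ j)) (i : Fin (d + 1)) :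
    |z₁ i - z i| ≤ |z₁ i - z₂ i| ∧ |z₂ i - z i| ≤ |z₁ i - z₂ i| := by
  have h3 := hz i
  rcases le_total (z₁ i) (z₂ i) with h12 | h12
  · rw [min_eq_left h12, max_eq_right h12] at h3
    rw [abs_of_nonpos (by omega : z₁ i - z₂ i ≤ 0), abs_le, abs_le]
    exact ⟨⟨by omega, by omega⟩, ⟨by omega, by omega⟩⟩
  · rw [min_eq_right h12, max_eq_left h12] at h3
    rw [abs_of_nonneg (by omega : 0 ≤ z₁ i - z₂ i), abs_le, abs_le]
    exact ⟨⟨by omega, by omega⟩, ⟨by omega, by omega⟩⟩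

/-- kernel: the sup-distance form — hull points are within `sup|z₁ − z₂|` of both end points. [folklore] -/
private theorem supNorm_sub_le_of_hull {z : Fin (d + 1) → ℤ} (hz : ∀ j, min (z₁ j) (z₂ j) ≤ z j ∧ z j ≤ max (z₁ j) (z₂ j)) {T : ℝ}
    (hclose : ∀ i, ((|z₁ i - z₂ i| : ℤ) : ℝ) ≤ T) : supNorm (z₁ - z) ≤ T ∧ supNorm (z₂ - z) ≤ T := by
  constructor
  · obtain ⟨i, hi⟩ := exists_supNorm_eq (z₁ - z)
    rw [hi, Pi.sub_apply]
    exact le_trans (by exact_mod_cast (abs_sub_le_of_hull hz i).1) (hclose i)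
  · obtain ⟨i, hi⟩ := exists_supNorm_eq (z₂ - z)
    rw [hi, Pi.sub_apply]
    exact le_trans (by exact_mod_cast (abs_sub_le_of_hull hz i).2) (hclose i)

/-- kernel: the `ℓ¹` length of the hull is at most `(d+1)·sup|z₁ − z₂|`. [folklore] -/
private theorem sum_abs_sub_le (T : ℝ) (hclose : ∀ i, ((|z₁ i - z₂ i| : ℤ) : ℝ) ≤ T) :
    ∑ j, ((|z₂ j - z₁ j| : ℤ) : ℝ) ≤ ((d : ℝ) + 1) * T := by
  calc ∑ j, ((|z₂ j - z₁ j| : ℤ) : ℝ) ≤ ∑ _j : Fin (d + 1), T :=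
        Finset.sum_le_sum fun j _ => by rw [abs_sub_comm]; exact hclose j
    _ = ((d : ℝ) + 1) * T := by rw [Finset.sum_const, Finset.card_univ, Fintype.card_fin, nsmul_eq_mul]; push_cast; ring

end Hull

section Weights

variable (hPd : P.d = d + 1) {n : ℕ} {c M0 : Fin (d + 1) → ℕ} {s : ℕ}

/-- kernel: `Fin.cast hPd.symm (Fin.cast hPd μ) = μ`. [folklore] -/
private theorem cast_cast₃ (μ : Fin P.d) : Fin.cast hPd.symm (Fin.cast hPd μ) = μ := Fin.ext rfl

/-- kernel: `cubePt (z + e_{cast μ}) = (cubePt z) + e_μ`. [cite: Balaban1983RegularityDecay, p.572, dictionary] -/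
private theorem cubePt_add_single' (z : Fin (d + 1) → ℤ) (μ : Fin P.d) :
    cubePt hPd n c (z + Pi.single (Fin.cast hPd μ) 1) = (cubePt hPd n c z).shift μ := by
  rw [cubePt_add_single, cast_cast₃]

/-- **the discrete product rule for MIXED second differences**: with `|ζ_b|, |λ_d| ≤ 1`, `|Δ²ζ| ≤ A`, `|Δ²λ| ≤ B`, first differences `≤ a`,
`≤ b`: `|ζ_dλ_d − ζ_cλ_c − ζ_bλ_b + ζ_aλ_a| ≤ A + B + 2ab`. [folklore] -/
private theorem abs_secondDiff4_mul_le {ζa ζb ζc ζd la lb lc ld A B a b : ℝ} (hζb : |ζb| ≤ 1) (hld : |ld| ≤ 1)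
    (hA : |ζd - ζc - ζb + ζa| ≤ A) (hB : |ld - lc - lb + la| ≤ B) (ha1 : |ζc - ζa| ≤ a) (ha2 : |ζb - ζa| ≤ a)
    (hb1 : |ld - lc| ≤ b) (hb2 : |lc - la| ≤ b) : |ζd * ld - ζc * lc - ζb * lb + ζa * la| ≤ A + B + 2 * (a * b) := by
  have hA0 : 0 ≤ A := (abs_nonneg _).trans hA
  have ha0 : 0 ≤ a := (abs_nonneg _).trans ha1
  have e : ζd * ld - ζc * lc - ζb * lb + ζa * la =
      (ζd - ζc - ζb + ζa) * ld + ζb * (ld - lc - lb + la) + ((ζc - ζa) * (ld - lc) + (ζb - ζa) * (lc - la)) := by ring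
  rw [e]
  refine (abs_add_le _ _).trans (add_le_add ((abs_add_le _ _).trans (add_le_add ?_ ?_)) ((abs_add_le _ _).trans ?_))
  · rw [abs_mul]
    calc |ζd - ζc - ζb + ζa| * |ld| ≤ A * 1 := mul_le_mul hA hld (abs_nonneg _) hA0
      _ = A := mul_one A
  · rw [abs_mul]
    calc |ζb| * |ld - lc - lb + la| ≤ 1 * B := mul_le_mul hζb hB (abs_nonneg _) zero_le_one
      _ = B := one_mul B
  · rw [abs_mul, abs_mul, two_mul]
    exact add_le_add (mul_le_mul ha1 hb1 (abs_nonneg _) ha0) (mul_le_mul ha2 hb2 (abs_nonneg _) ha0)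

/-- **THE MIXED SECOND DIFFERENCES OF THE ROW WEIGHTS `w_α(x, y) = ζ″(x, y)λ_α(x, y)` IN THE OUTPUT POINT** for ANY cut-off with `|ζ″| ≤ 1`,
one-step modulus `K₁` and second differences `≤ K₂`, and gen 26's weights of (2.27) (C^{1,1} on the lattice by `abs_cwt_secondDiff_le`): at
every chart point `z` with `z, z + e_i, z + e_m, z + e_i + e_m` in the box of `Ω₀`,
`|w(z + e_i + e_m) − w(z + e_i) − w(z + e_m) + w(z)| ≤ K₂ + 4π²/s² + 2K₁·3π(d+1)/(2s)`.
[cite: BalabanImbrieJaffe1988, (2.27)–(2.29) p.263] -/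
theorem abs_weight_secondDiff_le (hs : 0 < s) (hfit : ∀ i, c i * n + n * M0 i ≤ P.sitesPerDir 0) (hN : ∀ i, n * M0 i < P.sitesPerDir 0)
    {ζ : Balaban1983to89.Site P 0 → Balaban1983to89.Site P 0 → ℝ} {K₁ K₂ : ℝ} (hζabs : ∀ x y, |ζ x y| ≤ 1)
    (hζ1 : ∀ (x y : Balaban1983to89.Site P 0) (ν : Fin P.d), |ζ (x.shift ν) y - ζ x y| ≤ K₁)
    (hζ2 : ∀ (x y : Balaban1983to89.Site P 0) (κ ν : Fin P.d), |ζ ((x.shift ν).shift κ) y - ζ (x.shift ν) y - ζ (x.shift κ) y + ζ x y| ≤ K₂)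
    (α : Fin (d + 1) → ℤ) {z : Fin (d + 1) → ℤ} {i m : Fin (d + 1)} (hz : z ∈ boxDom fun j => n * M0 j)
    (hzi : z + Pi.single i 1 ∈ boxDom fun j => n * M0 j) (hzm : z + Pi.single m 1 ∈ boxDom fun j => n * M0 j)
    (hzim : z + Pi.single i 1 + Pi.single m 1 ∈ boxDom fun j => n * M0 j) (y : Balaban1983to89.Site P 0) :
    |ζ (cubePt hPd n c (z + Pi.single i 1 + Pi.single m 1)) y * lamT hPd n c M0 s α (cubePt hPd n c (z + Pi.single i 1 + Pi.single m 1)) y -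
        ζ (cubePt hPd n c (z + Pi.single i 1)) y * lamT hPd n c M0 s α (cubePt hPd n c (z + Pi.single i 1)) y -
        ζ (cubePt hPd n c (z + Pi.single m 1)) y * lamT hPd n c M0 s α (cubePt hPd n c (z + Pi.single m 1)) y +
        ζ (cubePt hPd n c z) y * lamT hPd n c M0 s α (cubePt hPd n c z) y| ≤
      K₂ + 4 * Real.pi ^ 2 / (s : ℝ) ^ 2 + 2 * (K₁ * (3 * Real.pi * (d + 1 : ℕ) / (2 * s))) := by
  -- the four points on the torus
  have ec : cubePt hPd n c (z + Pi.single i 1) = (cubePt hPd n c z).shift (Fin.cast hPd.symm i) := cubePt_add_single hPd z i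
  have eb : cubePt hPd n c (z + Pi.single m 1) = (cubePt hPd n c z).shift (Fin.cast hPd.symm m) := cubePt_add_single hPd z m
  have ed : cubePt hPd n c (z + Pi.single i 1 + Pi.single m 1) =
      ((cubePt hPd n c z).shift (Fin.cast hPd.symm i)).shift (Fin.cast hPd.symm m) := by rw [cubePt_add_single, ec]
  have hpΩ : cubePt hPd n c z ∈ (cubeT hPd n c fun j => n * M0 j) := cubePt_mem_cubeT hPd hz
  have hcΩ : (cubePt hPd n c z).shift (Fin.cast hPd.symm i) ∈ (cubeT hPd n c fun j => n * M0 j) := by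
    rw [← ec]; exact cubePt_mem_cubeT hPd hzi
  have hbΩ : (cubePt hPd n c z).shift (Fin.cast hPd.symm m) ∈ (cubeT hPd n c fun j => n * M0 j) := by
    rw [← eb]; exact cubePt_mem_cubeT hPd hzm
  have hdΩ : ((cubePt hPd n c z).shift (Fin.cast hPd.symm i)).shift (Fin.cast hPd.symm m) ∈ (cubeT hPd n c fun j => n * M0 j) := by
    rw [← ed]; exact cubePt_mem_cubeT hPd hzim
  rw [ed, ec, eb]
  -- the second differences of `λ_α`: through the chart weights when `y ∈ Ω₀`, identically `0` otherwise
  have hB : |lamT hPd n c M0 s α (((cubePt hPd n c z).shift (Fin.cast hPd.symm i)).shift (Fin.cast hPd.symm m)) y -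
      lamT hPd n c M0 s α ((cubePt hPd n c z).shift (Fin.cast hPd.symm i)) y -
      lamT hPd n c M0 s α ((cubePt hPd n c z).shift (Fin.cast hPd.symm m)) y + lamT hPd n c M0 s α (cubePt hPd n c z) y| ≤
      4 * Real.pi ^ 2 / (s : ℝ) ^ 2 := by
    by_cases hy : y ∈ (cubeT hPd n c fun j => n * M0 j)
    · rw [lamT_of_mem α hdΩ hy, lamT_of_mem α hcΩ hy, lamT_of_mem α hbΩ hy, lamT_of_mem α hpΩ hy, ← ed, ← ec, ← eb,
        boxCoord_cubePt hPd hfit hzim, boxCoord_cubePt hPd hfit hzi, boxCoord_cubePt hPd hfit hzm, boxCoord_cubePt hPd hfit hz]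
      exact abs_cwt_secondDiff_le hs α z _ i m
    · rw [lamT_of_not α (fun h => hy h.2), lamT_of_not α (fun h => hy h.2), lamT_of_not α (fun h => hy h.2),
        lamT_of_not α (fun h => hy h.2)]
      simp only [sub_zero, add_zero, abs_zero]
      positivity
  have hl : ∀ q : Balaban1983to89.Site P 0, |lamT hPd n c M0 s α q y| ≤ 1 := fun q => by
    rw [abs_of_nonneg (lamT_nonneg _ _ _)]
    by_cases hq : q ∈ (cubeT hPd n c fun j => n * M0 j) ∧ y ∈ (cubeT hPd n c fun j => n * M0 j)
    · rw [lamT_of_mem α hq.1 hq.2]; exact cwt_le_one _ _ _ _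
    · rw [lamT_of_not α hq]; exact zero_le_one
  exact abs_secondDiff4_mul_le (hζabs _ _) (hl _) (hζ2 (cubePt hPd n c z) y (Fin.cast hPd.symm m) (Fin.cast hPd.symm i)) hB
    (hζ1 (cubePt hPd n c z) y (Fin.cast hPd.symm i)) (hζ1 (cubePt hPd n c z) y (Fin.cast hPd.symm m))
    (abs_lamT_shift_sub_le hPd hs hfit hN α hcΩ hdΩ y) (abs_lamT_shift_sub_le hPd hs hfit hN α hpΩ hcΩ y)

variable {hPd}

/-- **THE ROW WEIGHTS OF TWO SHIFTED CHART POINTS DIFFER BY AT MOST `(K₁ + 3π(d+1)/(2s))·|z₂ − z₁|₁`** (telescoping the one-step bound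
`abs_weight_shift_sub_le` along a staircase in the coordinate hull of `z₁, z₂`, which stays in `Ω₀`): for ANY cut-off with `|ζ″| ≤ 1` and
one-step modulus `K₁`, all box points `z₁, z₂` leaving one row of room, every direction `μ` and every `y`,
`|w((z₂)+e_μ, y) − w((z₁)+e_μ, y)| ≤ (K₁ + 3π(d+1)/(2s))·Σ_j|z₂,j − z₁,j|`. [cite: BalabanImbrieJaffe1988, (2.27)–(2.29) p.263] -/
theorem abs_weight_shift_sub_le_of_hull (hs : 0 < s) (hfit : ∀ i, c i * n + n * M0 i ≤ P.sitesPerDir 0) (hN : ∀ i, n * M0 i < P.sitesPerDir 0)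
    {ζ : Balaban1983to89.Site P 0 → Balaban1983to89.Site P 0 → ℝ} {K₁ : ℝ} (hK₁ : 0 ≤ K₁) (hζabs : ∀ x y, |ζ x y| ≤ 1)
    (hζ1 : ∀ (x y : Balaban1983to89.Site P 0) (ν : Fin P.d), |ζ (x.shift ν) y - ζ x y| ≤ K₁) (α : Fin (d + 1) → ℤ)
    {z₁ z₂ : Fin (d + 1) → ℤ} (hz₁ : z₁ ∈ boxDom fun j => n * M0 j) (hz₂ : z₂ ∈ boxDom fun j => n * M0 j)
    (hroom₁ : ∀ j, z₁ j + 1 < ((n * M0 j : ℕ) : ℤ)) (hroom₂ : ∀ j, z₂ j + 1 < ((n * M0 j : ℕ) : ℤ)) (μ : Fin P.d)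
    (y : Balaban1983to89.Site P 0) :
    |ζ ((cubePt hPd n c z₂).shift μ) y * lamT hPd n c M0 s α ((cubePt hPd n c z₂).shift μ) y -
        ζ ((cubePt hPd n c z₁).shift μ) y * lamT hPd n c M0 s α ((cubePt hPd n c z₁).shift μ) y| ≤
      (K₁ + 3 * Real.pi * (d + 1 : ℕ) / (2 * s)) * ∑ j, ((|z₂ j - z₁ j| : ℤ) : ℝ) := by
  set μ' : Fin (d + 1) := Fin.cast hPd μ with hμ'def
  set Ψ : (Fin (d + 1) → ℤ) → ℝ := fun z =>
    ζ (cubePt hPd n c (z + Pi.single μ' 1)) y * lamT hPd n c M0 s α (cubePt hPd n c (z + Pi.single μ' 1)) y with hΨdef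
  have hΨ : ∀ z : Fin (d + 1) → ℤ, Ψ z = ζ ((cubePt hPd n c z).shift μ) y * lamT hPd n c M0 s α ((cubePt hPd n c z).shift μ) y := by
    intro z; simp only [hΨdef, hμ'def]; rw [cubePt_add_single' hPd]
  rw [← hΨ z₂, ← hΨ z₁, ← Real.norm_eq_abs]
  refine norm_sub_le_mul_l1_of_bond_bound (fun j => min (z₁ j) (z₂ j)) (fun j => max (z₁ j) (z₂ j)) Ψ ?_
    (fun j => ⟨min_le_left _ _, le_max_left _ _⟩) (fun j => ⟨min_le_right _ _, le_max_right _ _⟩)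
  intro z i hz hzi
  have hz' := hull_add_single hz hzi
  -- the stepped point `q = cubePt(z + e_μ') ∈ Ω₀` and its `i`-neighbour
  have hq : z + Pi.single μ' 1 ∈ boxDom (fun j => n * M0 j) := hull_add_single_mem_boxDom hz₁ hz₂ hroom₁ hroom₂ hz μ'
  have hqi : z + Pi.single i 1 + Pi.single μ' 1 ∈ boxDom (fun j => n * M0 j) := hull_add_single_mem_boxDom hz₁ hz₂ hroom₁ hroom₂ hz' μ'
  have e : cubePt hPd n c (z + Pi.single i 1 + Pi.single μ' 1) = (cubePt hPd n c (z + Pi.single μ' 1)).shift (Fin.cast hPd.symm i) := by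
    rw [add_right_comm, cubePt_add_single]
  rw [Real.norm_eq_abs]
  simp only [hΨdef]
  rw [e]
  have hqΩ : cubePt hPd n c (z + Pi.single μ' 1) ∈ (cubeT hPd n c fun j => n * M0 j) := cubePt_mem_cubeT hPd hq
  have hqiΩ : (cubePt hPd n c (z + Pi.single μ' 1)).shift (Fin.cast hPd.symm i) ∈ (cubeT hPd n c fun j => n * M0 j) := by
    rw [← e]; exact cubePt_mem_cubeT hPd hqi
  exact abs_weight_shift_sub_le hPd hs hfit hN hK₁ hζabs (fun y => hζ1 _ y _) α hqΩ hqiΩ y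

/-- **THE BOND DIFFERENCES `Δ_μw(·, y)` OF THE ROW WEIGHTS AT TWO CHART POINTS DIFFER BY AT MOST `Λ₂·|z₂ − z₁|₁`**, `Λ₂ = K₂ + 4π²/s² +
2K₁·3π(d+1)/(2s)` (telescoping the mixed second differences `abs_weight_secondDiff_le` along a staircase in the coordinate hull):
`|(w(z₂+e_μ, y) − w(z₂, y)) − (w(z₁+e_μ, y) − w(z₁, y))| ≤ Λ₂·Σ_j|z₂,j − z₁,j|`. [cite: BalabanImbrieJaffe1988, (2.27)–(2.29) p.263] -/
theorem abs_weight_bondDiff_sub_le_of_hull (hs : 0 < s) (hfit : ∀ i, c i * n + n * M0 i ≤ P.sitesPerDir 0)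
    (hN : ∀ i, n * M0 i < P.sitesPerDir 0) {ζ : Balaban1983to89.Site P 0 → Balaban1983to89.Site P 0 → ℝ} {K₁ K₂ : ℝ}
    (hζabs : ∀ x y, |ζ x y| ≤ 1) (hζ1 : ∀ (x y : Balaban1983to89.Site P 0) (ν : Fin P.d), |ζ (x.shift ν) y - ζ x y| ≤ K₁)
    (hζ2 : ∀ (x y : Balaban1983to89.Site P 0) (κ ν : Fin P.d), |ζ ((x.shift ν).shift κ) y - ζ (x.shift ν) y - ζ (x.shift κ) y + ζ x y| ≤ K₂)
    (α : Fin (d + 1) → ℤ) {z₁ z₂ : Fin (d + 1) → ℤ} (hz₁ : z₁ ∈ boxDom fun j => n * M0 j) (hz₂ : z₂ ∈ boxDom fun j => n * M0 j)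
    (hroom₁ : ∀ j, z₁ j + 1 < ((n * M0 j : ℕ) : ℤ)) (hroom₂ : ∀ j, z₂ j + 1 < ((n * M0 j : ℕ) : ℤ)) (μ : Fin P.d)
    (y : Balaban1983to89.Site P 0) :
    |(ζ ((cubePt hPd n c z₂).shift μ) y * lamT hPd n c M0 s α ((cubePt hPd n c z₂).shift μ) y -
          ζ (cubePt hPd n c z₂) y * lamT hPd n c M0 s α (cubePt hPd n c z₂) y) -
        (ζ ((cubePt hPd n c z₁).shift μ) y * lamT hPd n c M0 s α ((cubePt hPd n c z₁).shift μ) y -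
          ζ (cubePt hPd n c z₁) y * lamT hPd n c M0 s α (cubePt hPd n c z₁) y)| ≤
      (K₂ + 4 * Real.pi ^ 2 / (s : ℝ) ^ 2 + 2 * (K₁ * (3 * Real.pi * (d + 1 : ℕ) / (2 * s)))) * ∑ j, ((|z₂ j - z₁ j| : ℤ) : ℝ) := by
  set μ' : Fin (d + 1) := Fin.cast hPd μ with hμ'def
  set Ψ : (Fin (d + 1) → ℤ) → ℝ := fun z =>
    ζ (cubePt hPd n c (z + Pi.single μ' 1)) y * lamT hPd n c M0 s α (cubePt hPd n c (z + Pi.single μ' 1)) y -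
      ζ (cubePt hPd n c z) y * lamT hPd n c M0 s α (cubePt hPd n c z) y with hΨdef
  have hΨ : ∀ z : Fin (d + 1) → ℤ, Ψ z = ζ ((cubePt hPd n c z).shift μ) y * lamT hPd n c M0 s α ((cubePt hPd n c z).shift μ) y -
      ζ (cubePt hPd n c z) y * lamT hPd n c M0 s α (cubePt hPd n c z) y := by
    intro z; simp only [hΨdef, hμ'def]; rw [cubePt_add_single' hPd]
  rw [← hΨ z₂, ← hΨ z₁, ← Real.norm_eq_abs]
  refine norm_sub_le_mul_l1_of_bond_bound (fun j => min (z₁ j) (z₂ j)) (fun j => max (z₁ j) (z₂ j)) Ψ ?_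
    (fun j => ⟨min_le_left _ _, le_max_left _ _⟩) (fun j => ⟨min_le_right _ _, le_max_right _ _⟩)
  intro z i hz hzi
  have hz' := hull_add_single hz hzi
  have hzD : z ∈ boxDom (fun j => n * M0 j) := hull_mem_boxDom hz₁ hz₂ hz
  have hziD : z + Pi.single i 1 ∈ boxDom (fun j => n * M0 j) := hull_mem_boxDom hz₁ hz₂ hz'
  have hzmD : z + Pi.single μ' 1 ∈ boxDom (fun j => n * M0 j) := hull_add_single_mem_boxDom hz₁ hz₂ hroom₁ hroom₂ hz μ'
  have hzimD : z + Pi.single i 1 + Pi.single μ' 1 ∈ boxDom (fun j => n * M0 j) := hull_add_single_mem_boxDom hz₁ hz₂ hroom₁ hroom₂ hz' μ'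
  rw [Real.norm_eq_abs]
  simp only [hΨdef]
  have e : ∀ A B C D : ℝ, A - B - (C - D) = A - B - C + D := fun _ _ _ _ => by ring
  rw [e]
  exact abs_weight_secondDiff_le hPd hs hfit hN hζabs hζ1 hζ2 α hzD hziD hzmD hzimD y

end Weights

/-! ## §3 Gauge-covariant telescoping of a cube propagator's values along the hull -/

section Transport

variable (hPd : P.d = d + 1) {n : ℕ} {c : Fin (d + 1) → ℕ}

/-- **TELESCOPING THE TRANSPORTED DIFFERENCE OF VALUES ALONG A STAIRCASE IN THE CHART** (`Φ = h̄ψ`, one bond at a time: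
`Φ(b₊) − Φ(b₋) = h(b₋)⁻¹ε(D^{ε⁻¹}_uψ)(b)`, gen 28's `norm_rot_tgt_sub_rot_src`): if `‖(D_uψ)(b)‖ ≤ B` on every bond of the coordinate hull
of `z₁, z₂`, then `‖h(z₂)⁻¹ψ(z₂) − h(z₁)⁻¹ψ(z₁)‖ ≤ ε·B·|z₂ − z₁|₁`. [cite: Balaban1983RegularityDecay, (1.9) p.573] -/
theorem norm_rot_sub_le_of_covD_le (h : GaugeTransf P 0 U1) (ψ : Balaban1983to89.Site P 0 → ℂ) {z₁ z₂ : Fin (d + 1) → ℤ} {B : ℝ}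
    (hbond : ∀ (z : Fin (d + 1) → ℤ) (i : Fin (d + 1)), (∀ j, min (z₁ j) (z₂ j) ≤ z j ∧ z j ≤ max (z₁ j) (z₂ j)) →
      z i + 1 ≤ max (z₁ i) (z₂ i) →
        ‖covD P.eps⁻¹ (cfg (gaugeAct h (1 : GaugeField P 0 U1))) ψ ⟨cubePt hPd n c z, Fin.cast hPd.symm i⟩‖ ≤ B) :
    ‖(toC (h (cubePt hPd n c z₂)))⁻¹ * ψ (cubePt hPd n c z₂) - (toC (h (cubePt hPd n c z₁)))⁻¹ * ψ (cubePt hPd n c z₁)‖ ≤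
      P.eps * B * ∑ j, ((|z₂ j - z₁ j| : ℤ) : ℝ) := by
  have heps : 0 < P.eps := P.eps_pos
  set Ψ : (Fin (d + 1) → ℤ) → ℂ := fun z => (toC (h (cubePt hPd n c z)))⁻¹ * ψ (cubePt hPd n c z) with hΨdef
  show ‖Ψ z₂ - Ψ z₁‖ ≤ _
  refine norm_sub_le_mul_l1_of_bond_bound (fun j => min (z₁ j) (z₂ j)) (fun j => max (z₁ j) (z₂ j)) Ψ ?_
    (fun j => ⟨min_le_left _ _, le_max_left _ _⟩) (fun j => ⟨min_le_right _ _, le_max_right _ _⟩)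
  intro z i hz hzi
  have hsrc : (⟨cubePt hPd n c z, Fin.cast hPd.symm i⟩ : PBond P 0).src = cubePt hPd n c z := rfl
  have htgt : (⟨cubePt hPd n c z, Fin.cast hPd.symm i⟩ : PBond P 0).tgt = cubePt hPd n c (z + Pi.single i 1) :=
    (cubePt_add_single hPd z i).symm
  have hΨ : Ψ (z + Pi.single i 1) - Ψ z =
      (toC (h (⟨cubePt hPd n c z, Fin.cast hPd.symm i⟩ : PBond P 0).tgt))⁻¹ * ψ (⟨cubePt hPd n c z, Fin.cast hPd.symm i⟩ : PBond P 0).tgt -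
        (toC (h (⟨cubePt hPd n c z, Fin.cast hPd.symm i⟩ : PBond P 0).src))⁻¹ *
          ψ (⟨cubePt hPd n c z, Fin.cast hPd.symm i⟩ : PBond P 0).src := by
    rw [hsrc, htgt]
  rw [hΨ, norm_rot_tgt_sub_rot_src h (inv_ne_zero heps.ne') ψ _, abs_inv, abs_of_pos heps, inv_inv]
  exact mul_le_mul_of_nonneg_left (hbond z i hz hzi) heps.le

end Transport

/-! ## §4 The Hölder member of order `1 + θ` of (2.30) at flat backgrounds for a SMOOTH cut-off -/

section DerivHolder

/-- kernel: for `1 ≤ t` and `θ ≤ 1`, `t^θ ≤ t`. [folklore] -/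
private theorem rpow_le_self_of_one_le' {t θ : ℝ} (ht : 1 ≤ t) (hθ : θ ≤ 1) : t ^ θ ≤ t := by
  have h := Real.rpow_le_rpow_of_exponent_le ht hθ
  rwa [Real.rpow_one] at h

/-- kernel: `D_u` is linear in the function — `D_u(Gf)(b) − D_u(Gg)(b) = D_u(G(f − g))(b)`. [cite: BalabanImbrieJaffe1988, (3.2) p.265] -/
private theorem covD_mulVec_sub (c' : ℝ) (u : PBond P 0 → ℂ) (G : Matrix (Balaban1983to89.Site P 0) (Balaban1983to89.Site P 0) ℂ)
    (f g : Balaban1983to89.Site P 0 → ℂ) (b : PBond P 0) :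
    covD c' u (G *ᵥ f) b - covD c' u (G *ᵥ g) b = covD c' u (G *ᵥ (f - g)) b := by
  simp only [covD, Matrix.mulVec_sub, Pi.sub_apply]
  ring

/-- kernel: `D_u` of the zero function vanishes. [cite: BalabanImbrieJaffe1988, (3.2) p.265] -/
private theorem covD_zero (c' : ℝ) (u : PBond P 0 → ℂ) (b : PBond P 0) : covD c' u (0 : Balaban1983to89.Site P 0 → ℂ) b = 0 := by
  simp only [covD, Pi.zero_apply, mul_zero, sub_zero]

set_option maxHeartbeats 800000 in
/-- **THE HÖLDER MEMBER OF ORDER `1 + θ` (`0 ≤ θ < 1`) OF (2.30) AT EVERY PURE-GAUGE BACKGROUND `u = 1^h` FOR THE TORUS CUBES AND WEIGHTS OF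
RECORD AND A SMOOTH CUT-OFF** (p. 263: *"Bounds analogous to (2.30), (2.31) hold for covariant derivatives and Holder derivatives of G_{k,loc}(u)
of order less than two"* — the member of top order, the Hölder quotient of the covariant derivative, [6] (1.9) for `G_{k,loc}`).  For every
`0 ≤ θ < 1` and moduli `K₁, K₂ ≥ 0` THERE EXIST `δ₀, c₀ > 0` depending on `(d, ℓ, a, θ, K₁, K₂)` only such that for every volume, every
`1 ≤ k ≤ K`, every no-wrap box `Ω₀ = c·L^k + Π_i[0, L^kM₀_i)` shorter than HALF the torus leaving a torus gap `≥ R`, cube spacing `s ≥ 1`,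
half-width `W ≥ 2s/3 + R₀/2 + R`, radii `L^k + 2 < R`, `0 ≤ R₁ < R₀`, `L^k ≤ R₀`, EVERY real cut-off `ζ″` with `|ζ″| ≤ 1`, `ζ″(x, y) = 0` for
`|x − y|_T ≥ R₀`, first lattice differences in `x` bounded by `K₁/(R₀ − R₁)` and second ones by `K₂/(R₀ − R₁)²`, every pure gauge `h`, every
direction `μ`, all bonds `⟨x₁, x₁+e_μ⟩`, `⟨x₂, x₂+e_μ⟩` with their four end points in `Ω₀` at chart depth `≥ R₀`, and every `f` (`‖f‖_∞ ≤ F`)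
supported at sup-torus distance `≥ D ≥ 0` from `x₁` and from `x₂`:
`(L^k/|x₁ − x₂|_T)^θ·‖h(x₁)h(x₂)⁻¹(D_uG_{k,loc}(1^h)f)(x₂, μ) − (D_uG_{k,loc}(1^h)f)(x₁, μ)‖ ≤ (L^kε)·c₀·m·(1 + L^k((R₀ − R₁)⁻¹ + s⁻¹))²·e^{−δ₀D/L^k}·F`,
`m = (⌊(L^k − 1 + R₀)/s⌋ + 3)^{d+1}`, `(D_uψ)(x, μ) = ε⁻¹(u_{⟨x,x+e_μ⟩}ψ(x + e_μ) − ψ(x))`.  MECHANISM (near pairs `|x₁ − x₂|_T ≤ L^k`): the bond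
identity `covD_gLocT_apply` at both bonds and the four-term split — (A) [6] (1.9) for each active cube on the fixed row source of `x₂ + e_μ`
(`holder19_flat_cube_level`), (B) [6] (1.10) on the difference of the row sources of `x₂ + e_μ`, `x₁ + e_μ` (Lipschitz along the hull,
`abs_weight_shift_sub_le_of_hull`), (C) the transported difference of the VALUES of the cube propagators on the bond-difference source of `x₂`,
telescoped along the hull with [6] (1.10) per bond (`norm_rot_sub_le_of_covD_le`), (D) [6] (1.10)'s value member on the difference of the
bond-difference sources of `x₂` and `x₁` — a SECOND difference of the row weights (`abs_weight_bondDiff_sub_le_of_hull`, whence the smoothness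
of `ζ″` and `BIJ88ConvexWeights227SecondDiff`); far pairs: two derivative members (`deriv230_flat_of_lipschitz`).
[cite: BalabanImbrieJaffe1988, (2.30) p.263] -/
theorem derivHolder230_flat_of_smooth (d ℓ : ℕ) (hℓ : 1 ≤ ℓ) {a : ℝ} (ha : 0 < a) {θ : ℝ} (hθ0 : 0 ≤ θ) (hθ1 : θ < 1) {K₁ K₂ : ℝ}
    (hK₁ : 0 ≤ K₁) (hK₂ : 0 ≤ K₂) :
    ∃ δ₀ c₀ : ℝ, 0 < δ₀ ∧ 0 < c₀ ∧ ∀ (P : Params) (hPd : P.d = d + 1), P.L = ℓ + 1 →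
      ∀ k : ℕ, 1 ≤ k → k ≤ P.K → ∀ (c M0 : Fin (d + 1) → ℕ), (∀ i, 1 ≤ M0 i) →
        (∀ i, c i * P.L ^ k + P.L ^ k * M0 i ≤ P.sitesPerDir 0) → (∀ i, 2 * (P.L ^ k * M0 i) ≤ P.sitesPerDir 0) →
      ∀ (s W : ℕ), 1 ≤ s → ∀ (R R₀ R₁ : ℝ), (P.L : ℝ) ^ k + 2 < R → 0 ≤ R₁ → R₁ < R₀ → 2 * (s : ℝ) / 3 + R₀ / 2 + R ≤ W →
        (∀ i, ((P.L ^ k * M0 i : ℕ) : ℝ) + R ≤ P.sitesPerDir 0) → (P.L : ℝ) ^ k ≤ R₀ →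
      ∀ (ζ : Balaban1983to89.Site P 0 → Balaban1983to89.Site P 0 → ℝ), (∀ x y, |ζ x y| ≤ 1) →
        (∀ x y, R₀ ≤ B5Ineq137Torus.T P 0 x y → ζ x y = 0) →
        (∀ (x y : Balaban1983to89.Site P 0) (ν : Fin P.d), |ζ (x.shift ν) y - ζ x y| ≤ K₁ / (R₀ - R₁)) →
        (∀ (x y : Balaban1983to89.Site P 0) (κ ν : Fin P.d),
          |ζ ((x.shift ν).shift κ) y - ζ (x.shift ν) y - ζ (x.shift κ) y + ζ x y| ≤ K₂ / (R₀ - R₁) ^ 2) →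
      ∀ (h : GaugeTransf P 0 U1) (x₁ x₂ : Balaban1983to89.Site P 0) (μ : Fin P.d),
        x₁ ∈ (cubeT hPd (P.L ^ k) c fun i => P.L ^ k * M0 i) →
        (∀ i, R₀ ≤ (boxCoord hPd (P.L ^ k) c x₁ i : ℝ) ∧ (boxCoord hPd (P.L ^ k) c x₁ i : ℝ) + R₀ ≤ (P.L ^ k * M0 i : ℕ) - 1) →
        x₁.shift μ ∈ (cubeT hPd (P.L ^ k) c fun i => P.L ^ k * M0 i) →
        (∀ i, R₀ ≤ (boxCoord hPd (P.L ^ k) c (x₁.shift μ) i : ℝ) ∧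
          (boxCoord hPd (P.L ^ k) c (x₁.shift μ) i : ℝ) + R₀ ≤ (P.L ^ k * M0 i : ℕ) - 1) →
        x₂ ∈ (cubeT hPd (P.L ^ k) c fun i => P.L ^ k * M0 i) →
        (∀ i, R₀ ≤ (boxCoord hPd (P.L ^ k) c x₂ i : ℝ) ∧ (boxCoord hPd (P.L ^ k) c x₂ i : ℝ) + R₀ ≤ (P.L ^ k * M0 i : ℕ) - 1) →
        x₂.shift μ ∈ (cubeT hPd (P.L ^ k) c fun i => P.L ^ k * M0 i) →
        (∀ i, R₀ ≤ (boxCoord hPd (P.L ^ k) c (x₂.shift μ) i : ℝ) ∧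
          (boxCoord hPd (P.L ^ k) c (x₂.shift μ) i : ℝ) + R₀ ≤ (P.L ^ k * M0 i : ℕ) - 1) →
      ∀ (f : Balaban1983to89.Site P 0 → ℂ) (F D : ℝ), (∀ y, ‖f y‖ ≤ F) → 0 ≤ D →
        (∀ y, f y ≠ 0 → D ≤ B5Ineq137Torus.T P 0 x₁ y) → (∀ y, f y ≠ 0 → D ≤ B5Ineq137Torus.T P 0 x₂ y) →
        ((P.L : ℝ) ^ k / B5Ineq137Torus.T P 0 x₁ x₂) ^ θ *
          ‖toC (h x₁) * (toC (h x₂))⁻¹ *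
              covD P.eps⁻¹ (cfg (gaugeAct h (1 : GaugeField P 0 U1)))
                (gLocT (B1RG242Torus.α P a k * (P.L : ℝ) ^ (k * P.d)) P.eps⁻¹ (gaugeAct h (1 : GaugeField P 0 U1)) k
                  (cubeFam hPd (P.L ^ k) c M0 s W) (lamFam hPd (P.L ^ k) c M0 s) ζ *ᵥ f) ⟨x₂, μ⟩ -
            covD P.eps⁻¹ (cfg (gaugeAct h (1 : GaugeField P 0 U1)))
                (gLocT (B1RG242Torus.α P a k * (P.L : ℝ) ^ (k * P.d)) P.eps⁻¹ (gaugeAct h (1 : GaugeField P 0 U1)) k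
                  (cubeFam hPd (P.L ^ k) c M0 s W) (lamFam hPd (P.L ^ k) c M0 s) ζ *ᵥ f) ⟨x₁, μ⟩‖ ≤
          P.spacing k * (c₀ * (⌊(((P.L : ℝ) ^ k) - 1 + R₀) / s⌋₊ + 3) ^ (d + 1) *
            (1 + (P.L : ℝ) ^ k * ((R₀ - R₁)⁻¹ + (s : ℝ)⁻¹)) ^ 2 * Real.exp (-(δ₀ * (((P.L : ℝ) ^ k)⁻¹ * D))) * F) := by
  obtain ⟨δH, cH, hδH, hcH, HH⟩ := holder19_flat_cube_level d ℓ hℓ ha hθ0 hθ1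
  obtain ⟨δ₁, c₁, hδ₁, hc₁, H1⟩ := decay110_flat_cube_deriv_level d ℓ hℓ ha
  obtain ⟨δ₂, c₂, hδ₂, hc₂, H2⟩ := decay110_flat_cube_level d ℓ hℓ ha
  obtain ⟨δg, cg, hδg, hcg, Hg⟩ := deriv230_flat_of_lipschitz d ℓ hℓ ha hK₁
  -- the constants
  set Λ₀ : ℝ := max K₁ (3 * Real.pi * (d + 1 : ℕ) / 2) with hΛ₀def
  have hΛ₀0 : 0 ≤ Λ₀ := hK₁.trans (le_max_left _ _)
  set Λ₀₂ : ℝ := K₂ + 4 * Real.pi ^ 2 + 3 * Real.pi * (d + 1 : ℕ) * K₁ with hΛ₀₂def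
  have hΛ₀₂0 : 0 ≤ Λ₀₂ := by rw [hΛ₀₂def]; positivity
  set CB : ℝ := 2 * ((d : ℝ) + 1) * Λ₀ * c₁ with hCBdef
  set CC : ℝ := 2 * ((d : ℝ) + 1) * Real.exp δ₁ * Λ₀ * c₁ with hCCdef
  set CD : ℝ := 4 * ((d : ℝ) + 1) * Λ₀₂ * c₂ with hCDdef
  have hCB0 : 0 ≤ CB := by rw [hCBdef]; positivity
  have hCC0 : 0 ≤ CC := by rw [hCCdef]; positivity
  have hCD0 : 0 ≤ CD := by rw [hCDdef]; positivity
  set C : ℝ := cH + CB + CC + CD + 2 * cg with hCdef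
  have hC0 : 0 < C := by rw [hCdef]; positivity
  refine ⟨min (min δH δ₁) (min δ₂ δg), C, lt_min (lt_min hδH hδ₁) (lt_min hδ₂ hδg), hC0, ?_⟩
  intro P hPd hPL k hk1 hkK c M0 hM0 hfit0 hhalf s W hs R R₀ R₁ hR hR₁ hR10 hW hgap hLR₀ ζ hζabs hζ0 hζ1 hζ2 h x₁ x₂ μ
    hx₁ hdeep₁ hx₁e hdeep₁e hx₂ hdeep₂ hx₂e hdeep₂e f F D hF hD hsupp₁ hsupp₂
  set δ := min (min δH δ₁) (min δ₂ δg) with hδdef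
  have hδH' : δ ≤ δH := (min_le_left _ _).trans (min_le_left _ _)
  have hδ1 : δ ≤ δ₁ := (min_le_left _ _).trans (min_le_right _ _)
  have hδ2 : δ ≤ δ₂ := (min_le_right _ _).trans (min_le_left _ _)
  have hδg' : δ ≤ δg := (min_le_right _ _).trans (min_le_right _ _)
  -- elementary facts
  have hn : 1 ≤ P.L ^ k := Nat.one_le_pow _ _ P.L_pos
  have hk : 0 + k ≤ P.m + P.K := by omega
  have hN0 : ∀ i, P.L ^ k * M0 i < P.sitesPerDir 0 := fun i => by
    have := hhalf i; have := hM0 i; have : 1 ≤ P.L ^ k * M0 i := Nat.one_le_iff_ne_zero.2 (by positivity); omega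
  have hLpos : (0 : ℝ) < P.L := P.cast_L_pos
  have hLk : (0 : ℝ) < (P.L : ℝ) ^ k := pow_pos hLpos _
  have hLk1 : (1 : ℝ) ≤ (P.L : ℝ) ^ k := by exact_mod_cast hn
  have hLkinv : 0 < ((P.L : ℝ) ^ k)⁻¹ := inv_pos.mpr hLk
  have hR1 : 1 < R := by linarith only [hR, hLk]
  have hR0 : 0 ≤ R := by linarith only [hR, hLk]
  have hR₀ : 0 ≤ R₀ := hR₁.trans hR10.le
  have hR₀1 : 1 ≤ R₀ := hLk1.trans hLR₀
  have hs0 : 0 < s := hs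
  have hsr : (0 : ℝ) < s := by exact_mod_cast hs0
  have hgap' : 0 < R₀ - R₁ := sub_pos.2 hR10
  have hF0 : 0 ≤ F := (norm_nonneg _).trans (hF x₁)
  have hsp0 : 0 < P.spacing k := P.spacing_pos k
  have heps : 0 < P.eps := P.eps_pos
  have hK₁' : 0 ≤ K₁ / (R₀ - R₁) := div_nonneg hK₁ hgap'.le
  -- abbreviations
  set Ω₀ : Finset (Balaban1983to89.Site P 0) := cubeT hPd (P.L ^ k) c fun i => P.L ^ k * M0 i with hΩ₀def
  set A : ℝ := B1RG242Torus.α P a k * (P.L : ℝ) ^ (k * P.d) with hAdef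
  set U : GaugeField P 0 U1 := gaugeAct h (1 : GaugeField P 0 U1) with hUdef
  set x₁' := x₁.shift μ with hx₁'def
  set x₂' := x₂.shift μ with hx₂'def
  set T12 : ℝ := B5Ineq137Torus.T P 0 x₁ x₂ with hT12def
  have hT0 : 0 ≤ T12 := B5Ineq137Torus.T_nonneg P 0 x₁ x₂
  set m : ℝ := ((⌊(((P.L : ℝ) ^ k) - 1 + R₀) / s⌋₊ : ℝ) + 3) ^ (d + 1) with hmdef
  have hm0 : 0 ≤ m := by rw [hmdef]; positivity
  set uv : ℝ := (R₀ - R₁)⁻¹ + (s : ℝ)⁻¹ with huvdef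
  have huv0 : 0 ≤ uv := by rw [huvdef]; positivity
  set br : ℝ := 1 + (P.L : ℝ) ^ k * uv with hbrdef
  have hbr1 : 1 ≤ br := by rw [hbrdef]; exact le_add_of_nonneg_right (by positivity)
  have hbr0 : 0 ≤ br := zero_le_one.trans hbr1
  have hbr2 : br ≤ br ^ 2 := by
    calc br = 1 * br := (one_mul _).symm
      _ ≤ br * br := mul_le_mul_of_nonneg_right hbr1 hbr0
      _ = br ^ 2 := (sq br).symm
  have hLuv : (P.L : ℝ) ^ k * uv ≤ br := by rw [hbrdef]; exact le_add_of_nonneg_left zero_le_one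
  set Ex : ℝ := Real.exp (-(δ * (((P.L : ℝ) ^ k)⁻¹ * D))) with hEdef
  have hE0 : 0 < Ex := Real.exp_pos _
  have hεD : 0 ≤ ((P.L : ℝ) ^ k)⁻¹ * D := mul_nonneg hLkinv.le hD
  have hEH : Real.exp (-(δH * (((P.L : ℝ) ^ k)⁻¹ * D))) ≤ Ex := Real.exp_le_exp.2 (neg_le_neg (mul_le_mul_of_nonneg_right hδH' hεD))
  have hE1 : Real.exp (-(δ₁ * (((P.L : ℝ) ^ k)⁻¹ * D))) ≤ Ex := Real.exp_le_exp.2 (neg_le_neg (mul_le_mul_of_nonneg_right hδ1 hεD))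
  have hE2 : Real.exp (-(δ₂ * (((P.L : ℝ) ^ k)⁻¹ * D))) ≤ Ex := Real.exp_le_exp.2 (neg_le_neg (mul_le_mul_of_nonneg_right hδ2 hεD))
  have hEg : Real.exp (-(δg * (((P.L : ℝ) ^ k)⁻¹ * D))) ≤ Ex := Real.exp_le_exp.2 (neg_le_neg (mul_le_mul_of_nonneg_right hδg' hεD))
  -- the weight
  set w : ℝ := ((P.L : ℝ) ^ k / T12) ^ θ with hwdef
  have hw0 : 0 ≤ w := Real.rpow_nonneg (div_nonneg hLk.le hT0) θ
  -- the target, factorised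
  have hRHS : P.spacing k * (C * m * br ^ 2 * Ex * F) =
      P.spacing k * (C * (⌊(((P.L : ℝ) ^ k) - 1 + R₀) / s⌋₊ + 3) ^ (d + 1) *
        (1 + (P.L : ℝ) ^ k * ((R₀ - R₁)⁻¹ + (s : ℝ)⁻¹)) ^ 2 * Real.exp (-(δ * (((P.L : ℝ) ^ k)⁻¹ * D))) * F) := by
    rw [hmdef, hbrdef, huvdef, hEdef]
  rw [← hRHS]
  have hRHS0 : 0 ≤ P.spacing k * (C * m * br ^ 2 * Ex * F) := by positivity
  -- coincident points: the difference vanishes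
  by_cases hne : x₂ = x₁
  · rw [hne, mul_inv_cancel₀ (toC_ne_zero _), one_mul, sub_self, norm_zero, mul_zero]
    exact hRHS0
  -- the two derivative bounds of gen 28 (far pairs)
  by_cases hnear : (P.L : ℝ) ^ k < T12
  · -- FAR PAIRS: two derivative members
    have hTpos : 0 < T12 := hLk.trans hnear
    have hw1 : w ≤ 1 := by
      refine Real.rpow_le_one (div_nonneg hLk.le hT0) ?_ hθ0
      rw [div_le_one hTpos]; exact hnear.le
    have hg₁ := Hg P hPd hPL k hk1 hkK c M0 hM0 hfit0 hN0 s W hs R R₀ R₁ hR1 hR₁ hR10 hW hgap ζ hζabs hζ0 hζ1 h x₁ μ hx₁ hdeep₁ hx₁e hdeep₁e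
      f F D hF hD hsupp₁
    have hg₂ := Hg P hPd hPL k hk1 hkK c M0 hM0 hfit0 hN0 s W hs R R₀ R₁ hR1 hR₁ hR10 hW hgap ζ hζabs hζ0 hζ1 h x₂ μ hx₂ hdeep₂ hx₂e hdeep₂e
      f F D hF hD hsupp₂
    set X₁ := covD P.eps⁻¹ (cfg U) (gLocT A P.eps⁻¹ U k (cubeFam hPd (P.L ^ k) c M0 s W) (lamFam hPd (P.L ^ k) c M0 s) ζ *ᵥ f) ⟨x₁, μ⟩
      with hX₁def
    set X₂ := covD P.eps⁻¹ (cfg U) (gLocT A P.eps⁻¹ U k (cubeFam hPd (P.L ^ k) c M0 s W) (lamFam hPd (P.L ^ k) c M0 s) ζ *ᵥ f) ⟨x₂, μ⟩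
      with hX₂def
    have hBg : ∀ X : ℝ, X ≤ P.spacing k * (cg * m * br * Real.exp (-(δg * (((P.L : ℝ) ^ k)⁻¹ * D))) * F) →
        X ≤ P.spacing k * (cg * m * br * Ex * F) := fun X hX =>
      hX.trans (mul_le_mul_of_nonneg_left (mul_le_mul_of_nonneg_right (mul_le_mul_of_nonneg_left hEg (by positivity)) hF0) hsp0.le)
    have h1 : ‖X₁‖ ≤ P.spacing k * (cg * m * br * Ex * F) := hBg _ hg₁
    have h2 : ‖X₂‖ ≤ P.spacing k * (cg * m * br * Ex * F) := hBg _ hg₂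
    have hτ : ‖toC (h x₁) * (toC (h x₂))⁻¹ * X₂‖ = ‖X₂‖ := by
      rw [norm_mul, norm_mul, norm_inv, norm_toC, norm_toC, inv_one, one_mul, one_mul]
    calc w * ‖toC (h x₁) * (toC (h x₂))⁻¹ * X₂ - X₁‖ ≤ 1 * ‖toC (h x₁) * (toC (h x₂))⁻¹ * X₂ - X₁‖ :=
          mul_le_mul_of_nonneg_right hw1 (norm_nonneg _)
      _ ≤ ‖toC (h x₁) * (toC (h x₂))⁻¹ * X₂‖ + ‖X₁‖ := by rw [one_mul]; exact norm_sub_le _ _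
      _ ≤ P.spacing k * (cg * m * br * Ex * F) + P.spacing k * (cg * m * br * Ex * F) := by rw [hτ]; exact add_le_add h2 h1
      _ = P.spacing k * ((2 * cg) * m * br * Ex * F) := by ring
      _ ≤ P.spacing k * (C * m * br ^ 2 * Ex * F) := by
          refine mul_le_mul_of_nonneg_left ?_ hsp0.le
          have hc : 2 * cg ≤ C := by rw [hCdef]; linarith only [hcH.le, hCB0, hCC0, hCD0]
          have h3 : (2 * cg) * m * br ≤ C * m * br ^ 2 := mul_le_mul (mul_le_mul_of_nonneg_right hc hm0) hbr2 hbr0 (by positivity)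
          exact mul_le_mul_of_nonneg_right (mul_le_mul_of_nonneg_right h3 hE0.le) hF0
  /- NEAR PAIRS -/
  push Not at hnear
  -- chart coordinates and the hull
  obtain ⟨hz₁, hxz₁⟩ := cubePt_boxCoord hPd hfit0 hx₁
  obtain ⟨hz₂, hxz₂⟩ := cubePt_boxCoord hPd hfit0 hx₂
  set z₁ := boxCoord hPd (P.L ^ k) c x₁ with hz₁def
  set z₂ := boxCoord hPd (P.L ^ k) c x₂ with hz₂def
  have hdeepT : ∀ i, T12 ≤ (z₁ i : ℝ) ∧ (z₁ i : ℝ) + T12 ≤ (P.L ^ k * M0 i : ℕ) - 1 := fun i => by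
    have h1 := hdeep₁ i
    constructor <;> linarith only [h1.1, h1.2, hnear, hLR₀]
  have hclose : ∀ i, ((|z₁ i - z₂ i| : ℤ) : ℝ) ≤ T12 := (mem_and_abs_sub_le_of_T_le hPd hfit0 hdeepT le_rfl).2
  have hroom₁ : ∀ j, z₁ j + 1 < ((P.L ^ k * M0 j : ℕ) : ℤ) := fun j => by
    have h1 : ((z₁ j : ℤ) : ℝ) + 2 ≤ ((P.L ^ k * M0 j : ℕ) : ℝ) := by linarith only [(hdeep₁ j).2, hR₀1]
    have h2 : z₁ j + 2 ≤ ((P.L ^ k * M0 j : ℕ) : ℤ) := by exact_mod_cast h1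
    omega
  have hroom₂ : ∀ j, z₂ j + 1 < ((P.L ^ k * M0 j : ℕ) : ℤ) := fun j => by
    have h1 : ((z₂ j : ℤ) : ℝ) + 2 ≤ ((P.L ^ k * M0 j : ℕ) : ℝ) := by linarith only [(hdeep₂ j).2, hR₀1]
    have h2 : z₂ j + 2 ≤ ((P.L ^ k * M0 j : ℕ) : ℤ) := by exact_mod_cast h1
    omega
  have hl1 : ∑ j, ((|z₂ j - z₁ j| : ℤ) : ℝ) ≤ ((d : ℝ) + 1) * T12 := sum_abs_sub_le T12 hclose
  -- hull points: in `Ω₀`, within `T12` of `x₁` and of `x₂`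
  have hullDom : ∀ z : Fin (d + 1) → ℤ, (∀ j, min (z₁ j) (z₂ j) ≤ z j ∧ z j ≤ max (z₁ j) (z₂ j)) →
      z ∈ boxDom (fun i => P.L ^ k * M0 i) := fun z hz => hull_mem_boxDom hz₁ hz₂ hz
  have hullT : ∀ z : Fin (d + 1) → ℤ, (∀ j, min (z₁ j) (z₂ j) ≤ z j ∧ z j ≤ max (z₁ j) (z₂ j)) →
      B5Ineq137Torus.T P 0 x₁ (cubePt hPd (P.L ^ k) c z) ≤ T12 ∧ B5Ineq137Torus.T P 0 x₂ (cubePt hPd (P.L ^ k) c z) ≤ T12 := by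
    intro z hz
    obtain ⟨h1, h2⟩ := supNorm_sub_le_of_hull hz hclose
    constructor
    · have h3 := T_cubePt_le hPd hfit0 hz₁ (hullDom z hz)
      rw [hxz₁] at h3; exact h3.trans h1
    · have h3 := T_cubePt_le hPd hfit0 hz₂ (hullDom z hz)
      rw [hxz₂] at h3; exact h3.trans h2
  -- the shortened support distance along the hull
  set D' : ℝ := max (D - T12) 0 with hD'def
  have hD'supp : ∀ z : Fin (d + 1) → ℤ, (∀ j, min (z₁ j) (z₂ j) ≤ z j ∧ z j ≤ max (z₁ j) (z₂ j)) →
      ∀ y, f y ≠ 0 → D' ≤ B5Ineq137Torus.T P 0 (cubePt hPd (P.L ^ k) c z) y := by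
    intro z hz y hy
    refine max_le ?_ (B5Ineq137Torus.T_nonneg P 0 _ y)
    have h1 := hsupp₁ y hy
    have h2 := B5Ineq137Torus.T_triangle P 0 x₁ (cubePt hPd (P.L ^ k) c z) y
    linarith only [h1, h2, (hullT z hz).1]
  have hexpD' : Real.exp (-(δ₁ * (((P.L : ℝ) ^ k)⁻¹ * D'))) ≤ Real.exp δ₁ * Ex := by
    have h1 : D - T12 ≤ D' := le_max_left _ _
    have h2 : ((P.L : ℝ) ^ k)⁻¹ * T12 ≤ 1 := by rw [inv_mul_le_iff₀ hLk, mul_one]; exact hnear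
    have h3 : -(δ₁ * (((P.L : ℝ) ^ k)⁻¹ * D')) ≤ δ₁ + -(δ * (((P.L : ℝ) ^ k)⁻¹ * D)) := by
      have h4 : δ₁ * (((P.L : ℝ) ^ k)⁻¹ * (D - T12)) ≤ δ₁ * (((P.L : ℝ) ^ k)⁻¹ * D') :=
        mul_le_mul_of_nonneg_left (mul_le_mul_of_nonneg_left h1 hLkinv.le) hδ₁.le
      have h5 : δ * (((P.L : ℝ) ^ k)⁻¹ * D) ≤ δ₁ * (((P.L : ℝ) ^ k)⁻¹ * D) := mul_le_mul_of_nonneg_right hδ1 hεD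
      have h6 : δ₁ * (((P.L : ℝ) ^ k)⁻¹ * T12) ≤ δ₁ * 1 := mul_le_mul_of_nonneg_left h2 hδ₁.le
      have h7 : δ₁ * (((P.L : ℝ) ^ k)⁻¹ * (D - T12)) = δ₁ * (((P.L : ℝ) ^ k)⁻¹ * D) - δ₁ * (((P.L : ℝ) ^ k)⁻¹ * T12) := by ring
      linarith only [h4, h5, h6, h7]
    calc Real.exp (-(δ₁ * (((P.L : ℝ) ^ k)⁻¹ * D'))) ≤ Real.exp (δ₁ + -(δ * (((P.L : ℝ) ^ k)⁻¹ * D))) := Real.exp_le_exp.2 h3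
      _ = Real.exp δ₁ * Ex := by rw [Real.exp_add]
  -- the weight against one factor `T12`: `w·T12 ≤ L^k`
  have hwT : w * T12 ≤ (P.L : ℝ) ^ k := by
    rcases hT0.eq_or_lt with hT00 | hTpos
    · rw [← hT00, mul_zero]; exact hLk.le
    · have hq : 1 ≤ (P.L : ℝ) ^ k / T12 := by rw [le_div_iff₀ hTpos, one_mul]; exact hnear
      calc w * T12 ≤ (P.L : ℝ) ^ k / T12 * T12 := mul_le_mul_of_nonneg_right (rpow_le_self_of_one_le' hq hθ1.le) hT0
        _ = (P.L : ℝ) ^ k := div_mul_cancel₀ _ hTpos.ne'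
  -- distances between the four end points
  have hT2'2 : B5Ineq137Torus.T P 0 x₂' x₂ ≤ 1 := by rw [B5Ineq137Torus.T_symm]; exact T_shift_le_one x₂ μ
  have hT1'1 : B5Ineq137Torus.T P 0 x₁' x₁ ≤ 1 := by rw [B5Ineq137Torus.T_symm]; exact T_shift_le_one x₁ μ
  have hT21 : B5Ineq137Torus.T P 0 x₂ x₁ = T12 := by rw [B5Ineq137Torus.T_symm]
  have hT2'1 : B5Ineq137Torus.T P 0 x₂' x₁ ≤ 1 + T12 := by
    have := B5Ineq137Torus.T_triangle P 0 x₂' x₂ x₁; linarith only [this, hT2'2, hT21]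
  have hT2'1' : B5Ineq137Torus.T P 0 x₂' x₁' ≤ 2 + T12 := by
    have h1 := B5Ineq137Torus.T_triangle P 0 x₂' x₁ x₁'; have h2 := T_shift_le_one (P := P) x₁ μ; linarith only [h1, h2, hT2'1]
  -- the active-label sets of the four end points
  have hmem : ∀ x : Balaban1983to89.Site P 0, x ∈ blockK k (blkIter k x) := fun x => mem_blockK.2 rfl
  set S : Balaban1983to89.Site P 0 → Finset ↥(labels (P.L ^ k) M0 s) := fun p =>
    (activeLabels hPd (P.L ^ k) c s R₀ (blkIter k p)).subtype fun α => α ∈ labels (P.L ^ k) M0 s with hSdef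
  have hcard : ∀ p, ((S p).card : ℝ) ≤ m := fun p => by
    have h1 := card_subtype_activeLabels_le (hPd := hPd) (c := c) (M0 := M0) hn hs0 hR₀ (blkIter k p)
    have e : (((P.L ^ k : ℕ) : ℕ) : ℝ) = (P.L : ℝ) ^ k := by push_cast; rfl
    rw [e] at h1; exact h1
  have hS : ∀ (p : Balaban1983to89.Site P 0),
      (∀ i, R₀ ≤ (boxCoord hPd (P.L ^ k) c p i : ℝ) ∧ (boxCoord hPd (P.L ^ k) c p i : ℝ) + R₀ ≤ (P.L ^ k * M0 i : ℕ) - 1) →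
      ∀ (α : ↥(labels (P.L ^ k) M0 s)) (y : Balaban1983to89.Site P 0), ζ p y * lamFam hPd (P.L ^ k) c M0 s α p y ≠ 0 → α ∈ S p := by
    intro p hdeep α y hne'
    rw [hSdef, Finset.mem_subtype]
    exact mem_activeLabels_of_ne_zero_of_deep hk hs0 hfit0 hζ0 (hmem p) hdeep hne'
  -- an active cube at a deep point contains every point of `Ω₀` within torus distance `< R` of it
  have memα : ∀ (α : ↥(labels (P.L ^ k) M0 s)) (p : Balaban1983to89.Site P 0), p ∈ Ω₀ →
      (∀ i, R₀ ≤ (boxCoord hPd (P.L ^ k) c p i : ℝ) ∧ (boxCoord hPd (P.L ^ k) c p i : ℝ) + R₀ ≤ (P.L ^ k * M0 i : ℕ) - 1) →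
      (∃ y, ζ p y * lamFam hPd (P.L ^ k) c M0 s α p y ≠ 0) →
      ∀ q ∈ Ω₀, B5Ineq137Torus.T P 0 p q < R → q ∈ cubeFam hPd (P.L ^ k) c M0 s W α := by
    intro α p hp hdeep hex q hq hlt
    obtain ⟨y₀, hy₀⟩ := hex
    obtain ⟨-, -, hfar⟩ := rowHyp_ii hPd hn hs0 hfit0 hR0 hgap hW hζ0 hp hdeep α y₀ hy₀
    by_contra hnot
    exact absurd (hfar q hq hnot).1 (not_le.2 hlt)
  -- the row sources and their vanishing
  set gs : Balaban1983to89.Site P 0 → ↥(labels (P.L ^ k) M0 s) → Balaban1983to89.Site P 0 → ℂ :=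
    fun p α y => (ζ p y : ℂ) * (lamFam hPd (P.L ^ k) c M0 s α p y : ℂ) * f y with hgsdef
  set ds : Balaban1983to89.Site P 0 → Balaban1983to89.Site P 0 → ↥(labels (P.L ^ k) M0 s) → Balaban1983to89.Site P 0 → ℂ :=
    fun p p' α y => ((ζ p' y : ℂ) * (lamFam hPd (P.L ^ k) c M0 s α p' y : ℂ) - (ζ p y : ℂ) * (lamFam hPd (P.L ^ k) c M0 s α p y : ℂ)) * f y
    with hdsdef
  have hgs0 : ∀ (p : Balaban1983to89.Site P 0) (α : ↥(labels (P.L ^ k) M0 s)),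
      (¬∃ y, ζ p y * lamFam hPd (P.L ^ k) c M0 s α p y ≠ 0) → gs p α = 0 := by
    intro p α hex
    push Not at hex
    funext y; rw [hgsdef]; dsimp only; rw [← Complex.ofReal_mul, hex y, Complex.ofReal_zero, zero_mul]; rfl
  have hds0 : ∀ (p p' : Balaban1983to89.Site P 0) (α : ↥(labels (P.L ^ k) M0 s)),
      (¬∃ y, ζ p' y * lamFam hPd (P.L ^ k) c M0 s α p' y ≠ 0) → (¬∃ y, ζ p y * lamFam hPd (P.L ^ k) c M0 s α p y ≠ 0) → ds p p' α = 0 := by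
    intro p p' α hex' hex
    push Not at hex hex'
    funext y; rw [hdsdef]; dsimp only; rw [← Complex.ofReal_mul, ← Complex.ofReal_mul, hex y, hex' y]; simp
  have hgs_le : ∀ p α y, ‖gs p α y‖ ≤ F := fun p α y =>
    norm_rowSource_le (hζabs p y) (abs_lam_le_one (sum_abs_lamT_le_one hfit0) α p y) hF y
  have hgs_supp : ∀ p α y, gs p α y ≠ 0 → f y ≠ 0 := fun p α y hy => (rowSource_ne_zero hy).2
  have hds_supp : ∀ p p' α y, ds p p' α y ≠ 0 → f y ≠ 0 := fun p p' α y hy => right_ne_zero_of_mul hy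
  -- the bond identity at both bonds
  have hid₁ : covD P.eps⁻¹ (cfg U) (gLocT A P.eps⁻¹ U k (cubeFam hPd (P.L ^ k) c M0 s W) (lamFam hPd (P.L ^ k) c M0 s) ζ *ᵥ f) ⟨x₁, μ⟩ =
      ∑ α, covD P.eps⁻¹ (cfg U) (gBox A P.eps⁻¹ U k (cubeFam hPd (P.L ^ k) c M0 s W α) *ᵥ gs x₁' α) ⟨x₁, μ⟩ +
      ∑ α, ((P.eps⁻¹ : ℝ) : ℂ) * (gBox A P.eps⁻¹ U k (cubeFam hPd (P.L ^ k) c M0 s W α) *ᵥ ds x₁ x₁' α) x₁ :=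
    covD_gLocT_apply P.eps⁻¹ (cfg U) A P.eps⁻¹ U k (cubeFam hPd (P.L ^ k) c M0 s W) (lamFam hPd (P.L ^ k) c M0 s) ζ f ⟨x₁, μ⟩
  have hid₂ : covD P.eps⁻¹ (cfg U) (gLocT A P.eps⁻¹ U k (cubeFam hPd (P.L ^ k) c M0 s W) (lamFam hPd (P.L ^ k) c M0 s) ζ *ᵥ f) ⟨x₂, μ⟩ =
      ∑ α, covD P.eps⁻¹ (cfg U) (gBox A P.eps⁻¹ U k (cubeFam hPd (P.L ^ k) c M0 s W α) *ᵥ gs x₂' α) ⟨x₂, μ⟩ +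
      ∑ α, ((P.eps⁻¹ : ℝ) : ℂ) * (gBox A P.eps⁻¹ U k (cubeFam hPd (P.L ^ k) c M0 s W α) *ᵥ ds x₂ x₂' α) x₂ :=
    covD_gLocT_apply P.eps⁻¹ (cfg U) A P.eps⁻¹ U k (cubeFam hPd (P.L ^ k) c M0 s W) (lamFam hPd (P.L ^ k) c M0 s) ζ f ⟨x₂, μ⟩
  rw [hid₁, hid₂]
  -- the four families of summands
  set τ : ℂ := toC (h x₁) * (toC (h x₂))⁻¹ with hτdef
  set Ec : ℂ := ((P.eps⁻¹ : ℝ) : ℂ) with hEcdef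
  have hEc : ‖Ec‖ = P.eps⁻¹ := by rw [hEcdef, Complex.norm_real, Real.norm_eq_abs, abs_of_pos (inv_pos.mpr heps)]
  set G : ↥(labels (P.L ^ k) M0 s) → Matrix (Balaban1983to89.Site P 0) (Balaban1983to89.Site P 0) ℂ :=
    fun α => gBox A P.eps⁻¹ U k (cubeFam hPd (P.L ^ k) c M0 s W α) with hGdef
  set sA : ↥(labels (P.L ^ k) M0 s) → ℂ :=
    fun α => τ * covD P.eps⁻¹ (cfg U) (G α *ᵥ gs x₂' α) ⟨x₂, μ⟩ - covD P.eps⁻¹ (cfg U) (G α *ᵥ gs x₂' α) ⟨x₁, μ⟩ with hsAdef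
  set sB : ↥(labels (P.L ^ k) M0 s) → ℂ :=
    fun α => covD P.eps⁻¹ (cfg U) (G α *ᵥ gs x₂' α) ⟨x₁, μ⟩ - covD P.eps⁻¹ (cfg U) (G α *ᵥ gs x₁' α) ⟨x₁, μ⟩ with hsBdef
  set sC : ↥(labels (P.L ^ k) M0 s) → ℂ :=
    fun α => τ * (Ec * (G α *ᵥ ds x₂ x₂' α) x₂) - Ec * (G α *ᵥ ds x₂ x₂' α) x₁ with hsCdef
  set sD : ↥(labels (P.L ^ k) M0 s) → ℂ :=
    fun α => Ec * (G α *ᵥ ds x₂ x₂' α) x₁ - Ec * (G α *ᵥ ds x₁ x₁' α) x₁ with hsDdef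
  have hdecomp : τ * (∑ α, covD P.eps⁻¹ (cfg U) (G α *ᵥ gs x₂' α) ⟨x₂, μ⟩ + ∑ α, Ec * (G α *ᵥ ds x₂ x₂' α) x₂) -
      (∑ α, covD P.eps⁻¹ (cfg U) (G α *ᵥ gs x₁' α) ⟨x₁, μ⟩ + ∑ α, Ec * (G α *ᵥ ds x₁ x₁' α) x₁) =
      (∑ α, sA α + ∑ α, sB α) + (∑ α, sC α + ∑ α, sD α) := by
    simp only [hsAdef, hsBdef, hsCdef, hsDdef, hGdef, Finset.sum_sub_distrib, mul_add, Finset.mul_sum]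
    ring
  /- TERM A: [6] (1.9) for each cube active at `x₂'`, fixed source -/
  set BA : ℝ := P.spacing k * (cH * Real.exp (-(δH * (((P.L : ℝ) ^ k)⁻¹ * D))) * F) with hBAdef
  have hBA0 : 0 ≤ BA := by rw [hBAdef]; positivity
  have hsA0 : ∀ α, gs x₂' α = 0 → sA α = 0 := fun α h0 => by
    simp only [hsAdef]; rw [h0, mulVec_zero, covD_zero, covD_zero, mul_zero, sub_zero]
  have htermA : ∀ α, w * ‖sA α‖ ≤ BA := by
    intro α
    by_cases hex : ∃ y, ζ x₂' y * lamFam hPd (P.L ^ k) c M0 s α x₂' y ≠ 0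
    · obtain ⟨t, M', hM', hnest, hcα⟩ := cubeFam_nested (hPd := hPd) (n := P.L ^ k) (c := c) (s := s) (W := W) hM0 α
      have hfit' : ∀ i, (c + t) i * P.L ^ k + P.L ^ k * M' i ≤ P.sitesPerDir 0 := fit_of_nested hnest hfit0
      have hhalf' : ∀ i, 2 * (P.L ^ k * M' i) ≤ P.sitesPerDir 0 := fun i =>
        le_trans (Nat.mul_le_mul_left 2 (Nat.mul_le_mul_left _ ((Nat.le_add_left _ _).trans (hnest i)))) (hhalf i)
      have h2' : x₂' ∈ cubeFam hPd (P.L ^ k) c M0 s W α :=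
        memα α x₂' hx₂e hdeep₂e hex x₂' hx₂e (by rw [B5Ineq137Torus.T_self]; exact zero_lt_one.trans hR1)
      have h2 : x₂ ∈ cubeFam hPd (P.L ^ k) c M0 s W α := memα α x₂' hx₂e hdeep₂e hex x₂ hx₂ (by linarith only [hT2'2, hR1])
      have h1 : x₁ ∈ cubeFam hPd (P.L ^ k) c M0 s W α := memα α x₂' hx₂e hdeep₂e hex x₁ hx₁ (by linarith only [hT2'1, hnear, hR])
      have h1' : x₁' ∈ cubeFam hPd (P.L ^ k) c M0 s W α :=
        memα α x₂' hx₂e hdeep₂e hex x₁' hx₁e (by linarith only [hT2'1', hnear, hR])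
      rw [hcα] at h2' h2 h1 h1'
      have key := HH P hPd hPL k hk1 hkK (c + t) M' hM' hfit' hhalf' h μ x₁ x₂ hne h1 h1' h2 h2' (gs x₂' α) F D (hgs_le x₂' α)
        (fun y hy => hsupp₁ y (hgs_supp x₂' α y hy)) (fun y hy => hsupp₂ y (hgs_supp x₂' α y hy))
      rw [← hcα] at key
      exact key
    · rw [hsA0 α (hgs0 x₂' α hex), norm_zero, mul_zero]; exact hBA0
  have hzeroA : ∀ α, α ∉ S x₂' → sA α = 0 := fun α hα =>
    hsA0 α (hgs0 x₂' α fun ⟨y, hy⟩ => hα (hS x₂' hdeep₂e α y hy))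
  have hsumA : w * ‖∑ α, sA α‖ ≤ m * BA := by
    rw [← Finset.sum_subset (Finset.subset_univ (S x₂')) (fun α _ hα => hzeroA α hα)]
    calc w * ‖∑ α ∈ S x₂', sA α‖ ≤ w * ∑ α ∈ S x₂', ‖sA α‖ := mul_le_mul_of_nonneg_left (norm_sum_le _ _) hw0
      _ = ∑ α ∈ S x₂', w * ‖sA α‖ := Finset.mul_sum _ _ _
      _ ≤ ∑ α ∈ S x₂', BA := Finset.sum_le_sum fun α _ => htermA α
      _ = (S x₂').card * BA := by rw [Finset.sum_const, nsmul_eq_mul]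
      _ ≤ m * BA := mul_le_mul_of_nonneg_right (hcard x₂') hBA0
  /- TERM B: [6] (1.10) on the difference of the row sources of `x₂'` and `x₁'` -/
  set Λ₁ : ℝ := K₁ / (R₀ - R₁) + 3 * Real.pi * (d + 1 : ℕ) / (2 * s) with hΛ₁def
  have hΛ₁0 : 0 ≤ Λ₁ := by rw [hΛ₁def]; positivity
  set dB : ↥(labels (P.L ^ k) M0 s) → Balaban1983to89.Site P 0 → ℂ := fun α y =>
    ((ζ x₂' y * lamFam hPd (P.L ^ k) c M0 s α x₂' y - ζ x₁' y * lamFam hPd (P.L ^ k) c M0 s α x₁' y : ℝ) : ℂ) * f y with hdBdef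
  have hdB : ∀ α, gs x₂' α - gs x₁' α = dB α := fun α => by
    funext y; simp only [hgsdef, hdBdef, Pi.sub_apply]; push_cast; ring
  have hsB_eq : ∀ α, sB α = covD P.eps⁻¹ (cfg U) (G α *ᵥ dB α) ⟨x₁, μ⟩ := fun α => by
    simp only [hsBdef]; rw [covD_mulVec_sub, hdB]
  have hdB_le : ∀ α y, ‖dB α y‖ ≤ Λ₁ * (((d : ℝ) + 1) * T12) * F := by
    intro α y
    have h1 := abs_weight_shift_sub_le_of_hull (hPd := hPd) (c := c) hs0 hfit0 hN0 hK₁' hζabs hζ1 α.1 hz₁ hz₂ hroom₁ hroom₂ μ y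
    rw [hxz₁, hxz₂] at h1
    simp only [hdBdef]
    rw [norm_mul, Complex.norm_real, Real.norm_eq_abs]
    refine mul_le_mul (h1.trans ?_) (hF y) (norm_nonneg _) (by positivity)
    exact mul_le_mul_of_nonneg_left hl1 hΛ₁0
  set BB : ℝ := P.spacing k * (c₁ * Real.exp (-(δ₁ * (((P.L : ℝ) ^ k)⁻¹ * D))) * (Λ₁ * (((d : ℝ) + 1) * T12) * F)) with hBBdef
  have hBB0 : 0 ≤ BB := by rw [hBBdef]; positivity
  have htermB : ∀ α, ‖sB α‖ ≤ BB := by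
    intro α
    by_cases hex : (∃ y, ζ x₂' y * lamFam hPd (P.L ^ k) c M0 s α x₂' y ≠ 0) ∨ (∃ y, ζ x₁' y * lamFam hPd (P.L ^ k) c M0 s α x₁' y ≠ 0)
    · obtain ⟨c', M', hM', hfit', hN', hcα⟩ := cubeFam_fits (hPd := hPd) (s := s) (W := W) hM0 hfit0 hN0 α
      have hxα : x₁ ∈ cubeFam hPd (P.L ^ k) c M0 s W α ∧ x₁' ∈ cubeFam hPd (P.L ^ k) c M0 s W α := by
        rcases hex with hex | hex
        · exact ⟨memα α x₂' hx₂e hdeep₂e hex x₁ hx₁ (by linarith only [hT2'1, hnear, hR]),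
            memα α x₂' hx₂e hdeep₂e hex x₁' hx₁e (by linarith only [hT2'1', hnear, hR])⟩
        · exact ⟨memα α x₁' hx₁e hdeep₁e hex x₁ hx₁ (by linarith only [hT1'1, hR1]),
            memα α x₁' hx₁e hdeep₁e hex x₁' hx₁e (by rw [B5Ineq137Torus.T_self]; exact zero_lt_one.trans hR1)⟩
      obtain ⟨h1, h1'⟩ := hxα
      rw [hcα] at h1 h1'
      have key := H1 P hPd hPL k hk1 hkK c' M' hM' hfit' hN' h x₁ (dB α) (Λ₁ * (((d : ℝ) + 1) * T12) * F) D (hdB_le α)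
        (fun y hy => hsupp₁ y (right_ne_zero_of_mul hy)) μ h1 h1'
      rw [← hcα] at key
      rw [hsB_eq α]; exact key
    · push Not at hex
      simp only [hsBdef]
      rw [hgs0 x₂' α (not_exists.2 fun y hy => hy (hex.1 y)), hgs0 x₁' α (not_exists.2 fun y hy => hy (hex.2 y))]
      simp only [mulVec_zero, covD_zero, sub_self, norm_zero]
      exact hBB0
  have hzeroB : ∀ α, α ∉ S x₂' ∪ S x₁' → sB α = 0 := by
    intro α hα
    rw [Finset.mem_union, not_or] at hα
    simp only [hsBdef]
    rw [hgs0 x₂' α fun ⟨y, hy⟩ => hα.1 (hS x₂' hdeep₂e α y hy), hgs0 x₁' α fun ⟨y, hy⟩ => hα.2 (hS x₁' hdeep₁e α y hy)]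
    simp only [mulVec_zero, covD_zero, sub_self]
  have hsumB : ‖∑ α, sB α‖ ≤ 2 * m * BB := by
    rw [← Finset.sum_subset (Finset.subset_univ (S x₂' ∪ S x₁')) (fun α _ hα => hzeroB α hα)]
    have hcardU : (((S x₂' ∪ S x₁').card : ℕ) : ℝ) ≤ 2 * m := by
      have h1 : (((S x₂' ∪ S x₁').card : ℕ) : ℝ) ≤ ((S x₂').card : ℝ) + ((S x₁').card : ℝ) := by
        exact_mod_cast Finset.card_union_le _ _
      linarith only [h1, hcard x₂', hcard x₁']
    calc ‖∑ α ∈ S x₂' ∪ S x₁', sB α‖ ≤ ∑ α ∈ S x₂' ∪ S x₁', ‖sB α‖ := norm_sum_le _ _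
      _ ≤ ∑ α ∈ S x₂' ∪ S x₁', BB := Finset.sum_le_sum fun α _ => htermB α
      _ = (S x₂' ∪ S x₁').card * BB := by rw [Finset.sum_const, nsmul_eq_mul]
      _ ≤ 2 * m * BB := mul_le_mul_of_nonneg_right hcardU hBB0
  /- TERM C: the transported difference of the values of `G_α(Δ_μ-source of x₂)` between `x₁` and `x₂`, telescoped along the hull -/
  have hds_le : ∀ α y, ‖ds x₂ x₂' α y‖ ≤ Λ₁ * F := fun α y =>
    norm_rowSource_sub_le_of_lipschitz hPd hs0 hfit0 hN0 hK₁' hζabs (fun y => hζ1 x₂ y μ) α.1 hx₂ hx₂e hF y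
  set BC : ℝ := P.spacing k * (c₁ * Real.exp (-(δ₁ * (((P.L : ℝ) ^ k)⁻¹ * D'))) * (Λ₁ * F)) with hBCdef
  have hBC0 : 0 ≤ BC := by rw [hBCdef]; positivity
  have htermC : ∀ α, ‖sC α‖ ≤ BC * (((d : ℝ) + 1) * T12) := by
    intro α
    by_cases hex : (∃ y, ζ x₂' y * lamFam hPd (P.L ^ k) c M0 s α x₂' y ≠ 0) ∨ (∃ y, ζ x₂ y * lamFam hPd (P.L ^ k) c M0 s α x₂ y ≠ 0)
    · obtain ⟨c', M', hM', hfit', hN', hcα⟩ := cubeFam_fits (hPd := hPd) (s := s) (W := W) hM0 hfit0 hN0 α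
      -- every hull bond lies in `□_α`
      have hullα : ∀ q ∈ Ω₀, B5Ineq137Torus.T P 0 x₂ q ≤ T12 + 1 → q ∈ cubeFam hPd (P.L ^ k) c M0 s W α := by
        intro q hq hTq
        rcases hex with hex | hex
        · refine memα α x₂' hx₂e hdeep₂e hex q hq ?_
          have := B5Ineq137Torus.T_triangle P 0 x₂' x₂ q; linarith only [this, hT2'2, hTq, hnear, hR]
        · exact memα α x₂ hx₂ hdeep₂ hex q hq (by linarith only [hTq, hnear, hR])
      have hbond : ∀ (z : Fin (d + 1) → ℤ) (i : Fin (d + 1)), (∀ j, min (z₁ j) (z₂ j) ≤ z j ∧ z j ≤ max (z₁ j) (z₂ j)) →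
          z i + 1 ≤ max (z₁ i) (z₂ i) →
          ‖covD P.eps⁻¹ (cfg U) (G α *ᵥ ds x₂ x₂' α) ⟨cubePt hPd (P.L ^ k) c z, Fin.cast hPd.symm i⟩‖ ≤ BC := by
        intro z i hz hzi
        have hz' := hull_add_single hz hzi
        have hpΩ : cubePt hPd (P.L ^ k) c z ∈ Ω₀ := cubePt_mem_cubeT hPd (hullDom z hz)
        have e : (cubePt hPd (P.L ^ k) c z).shift (Fin.cast hPd.symm i) = cubePt hPd (P.L ^ k) c (z + Pi.single i 1) :=
          (cubePt_add_single hPd z i).symm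
        have hpiΩ : (cubePt hPd (P.L ^ k) c z).shift (Fin.cast hPd.symm i) ∈ Ω₀ := by rw [e]; exact cubePt_mem_cubeT hPd (hullDom _ hz')
        have hpα : cubePt hPd (P.L ^ k) c z ∈ cubeFam hPd (P.L ^ k) c M0 s W α := hullα _ hpΩ (by linarith only [(hullT z hz).2])
        have hpiα : (cubePt hPd (P.L ^ k) c z).shift (Fin.cast hPd.symm i) ∈ cubeFam hPd (P.L ^ k) c M0 s W α := by
          refine hullα _ hpiΩ ?_
          have h1 := B5Ineq137Torus.T_triangle P 0 x₂ (cubePt hPd (P.L ^ k) c z) ((cubePt hPd (P.L ^ k) c z).shift (Fin.cast hPd.symm i))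
          have h2 := T_shift_le_one (P := P) (cubePt hPd (P.L ^ k) c z) (Fin.cast hPd.symm i)
          linarith only [h1, h2, (hullT z hz).2]
        rw [hcα] at hpα hpiα
        have key := H1 P hPd hPL k hk1 hkK c' M' hM' hfit' hN' h (cubePt hPd (P.L ^ k) c z) (ds x₂ x₂' α) (Λ₁ * F) D' (hds_le α)
          (fun y hy => hD'supp z hz y (hds_supp x₂ x₂' α y hy)) (Fin.cast hPd.symm i) hpα hpiα
        rw [← hcα] at key
        exact key
      have htel := norm_rot_sub_le_of_covD_le hPd h (G α *ᵥ ds x₂ x₂' α) hbond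
      rw [hxz₁, hxz₂] at htel
      have e : sC α = Ec * (τ * (G α *ᵥ ds x₂ x₂' α) x₂ - (G α *ᵥ ds x₂ x₂' α) x₁) := by simp only [hsCdef]; ring
      rw [e, norm_mul, hEc, hτdef, norm_transport_sub h (G α *ᵥ ds x₂ x₂' α) x₁ x₂]
      calc P.eps⁻¹ * ‖(toC (h x₂))⁻¹ * (G α *ᵥ ds x₂ x₂' α) x₂ - (toC (h x₁))⁻¹ * (G α *ᵥ ds x₂ x₂' α) x₁‖
          ≤ P.eps⁻¹ * (P.eps * BC * ∑ j, ((|z₂ j - z₁ j| : ℤ) : ℝ)) := mul_le_mul_of_nonneg_left htel (inv_pos.mpr heps).le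
        _ = BC * ∑ j, ((|z₂ j - z₁ j| : ℤ) : ℝ) := by rw [← mul_assoc, ← mul_assoc, inv_mul_cancel₀ heps.ne', one_mul]
        _ ≤ BC * (((d : ℝ) + 1) * T12) := mul_le_mul_of_nonneg_left hl1 hBC0
    · push Not at hex
      simp only [hsCdef]
      rw [hds0 x₂ x₂' α (not_exists.2 fun y hy => hy (hex.1 y)) (not_exists.2 fun y hy => hy (hex.2 y))]
      simp only [mulVec_zero, Pi.zero_apply, mul_zero, sub_zero, norm_zero]
      positivity
  have hzeroC : ∀ α, α ∉ S x₂' ∪ S x₂ → sC α = 0 := by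
    intro α hα
    rw [Finset.mem_union, not_or] at hα
    simp only [hsCdef]
    rw [hds0 x₂ x₂' α (fun ⟨y, hy⟩ => hα.1 (hS x₂' hdeep₂e α y hy)) (fun ⟨y, hy⟩ => hα.2 (hS x₂ hdeep₂ α y hy))]
    simp only [mulVec_zero, Pi.zero_apply, mul_zero, sub_zero]
  have hsumC : ‖∑ α, sC α‖ ≤ 2 * m * (BC * (((d : ℝ) + 1) * T12)) := by
    rw [← Finset.sum_subset (Finset.subset_univ (S x₂' ∪ S x₂)) (fun α _ hα => hzeroC α hα)]
    have hcardU : (((S x₂' ∪ S x₂).card : ℕ) : ℝ) ≤ 2 * m := by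
      have h1 : (((S x₂' ∪ S x₂).card : ℕ) : ℝ) ≤ ((S x₂').card : ℝ) + ((S x₂).card : ℝ) := by
        exact_mod_cast Finset.card_union_le _ _
      linarith only [h1, hcard x₂', hcard x₂]
    calc ‖∑ α ∈ S x₂' ∪ S x₂, sC α‖ ≤ ∑ α ∈ S x₂' ∪ S x₂, ‖sC α‖ := norm_sum_le _ _
      _ ≤ ∑ α ∈ S x₂' ∪ S x₂, BC * (((d : ℝ) + 1) * T12) := Finset.sum_le_sum fun α _ => htermC α
      _ = (S x₂' ∪ S x₂).card * (BC * (((d : ℝ) + 1) * T12)) := by rw [Finset.sum_const, nsmul_eq_mul]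
      _ ≤ 2 * m * (BC * (((d : ℝ) + 1) * T12)) := mul_le_mul_of_nonneg_right hcardU (by positivity)
  /- TERM D: [6] (1.10), value member, on the difference of the bond-difference sources of `x₂` and `x₁` -/
  set Λ₂ : ℝ := K₂ / (R₀ - R₁) ^ 2 + 4 * Real.pi ^ 2 / (s : ℝ) ^ 2 + 2 * (K₁ / (R₀ - R₁) * (3 * Real.pi * (d + 1 : ℕ) / (2 * s)))
    with hΛ₂def
  have hΛ₂0 : 0 ≤ Λ₂ := by rw [hΛ₂def]; positivity
  set dD : ↥(labels (P.L ^ k) M0 s) → Balaban1983to89.Site P 0 → ℂ := fun α y =>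
    (((ζ x₂' y * lamFam hPd (P.L ^ k) c M0 s α x₂' y - ζ x₂ y * lamFam hPd (P.L ^ k) c M0 s α x₂ y) -
        (ζ x₁' y * lamFam hPd (P.L ^ k) c M0 s α x₁' y - ζ x₁ y * lamFam hPd (P.L ^ k) c M0 s α x₁ y) : ℝ) : ℂ) * f y with hdDdef
  have hdD : ∀ α, ds x₂ x₂' α - ds x₁ x₁' α = dD α := fun α => by
    funext y; simp only [hdsdef, hdDdef, Pi.sub_apply]; push_cast; ring
  have hdD' : ∀ α, G α *ᵥ ds x₂ x₂' α - G α *ᵥ ds x₁ x₁' α = G α *ᵥ dD α := fun α => by rw [← Matrix.mulVec_sub, hdD]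
  have hsD_eq : ∀ α, sD α = Ec * (G α *ᵥ dD α) x₁ := fun α => by
    simp only [hsDdef]; rw [← mul_sub, ← hdD', Pi.sub_apply]
  have hdD_le : ∀ α y, ‖dD α y‖ ≤ Λ₂ * (((d : ℝ) + 1) * T12) * F := by
    intro α y
    have h1 := abs_weight_bondDiff_sub_le_of_hull (hPd := hPd) (c := c) hs0 hfit0 hN0 hζabs hζ1 hζ2 α.1 hz₁ hz₂ hroom₁ hroom₂ μ y
    rw [hxz₁, hxz₂] at h1
    simp only [hdDdef]
    rw [norm_mul, Complex.norm_real, Real.norm_eq_abs]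
    refine mul_le_mul (h1.trans ?_) (hF y) (norm_nonneg _) (by positivity)
    exact mul_le_mul_of_nonneg_left hl1 hΛ₂0
  set BD : ℝ := P.spacing k ^ 2 * (c₂ * Real.exp (-(δ₂ * (((P.L : ℝ) ^ k)⁻¹ * D))) * (Λ₂ * (((d : ℝ) + 1) * T12) * F)) with hBDdef
  have hBD0 : 0 ≤ BD := by rw [hBDdef]; positivity
  have htermD : ∀ α, ‖sD α‖ ≤ P.eps⁻¹ * BD := by
    intro α
    obtain ⟨c', M', hM', hfit', hN', hcα⟩ := cubeFam_fits (hPd := hPd) (s := s) (W := W) hM0 hfit0 hN0 α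
    have key := H2 P hPd hPL k hk1 hkK c' M' hM' hfit' hN' h x₁ (dD α) (Λ₂ * (((d : ℝ) + 1) * T12) * F) D (hdD_le α)
      (fun y hy => hsupp₁ y (right_ne_zero_of_mul hy))
    rw [hsD_eq α, norm_mul, hEc]
    refine mul_le_mul_of_nonneg_left ?_ (inv_pos.mpr heps).le
    rw [← hcα] at key
    exact key
  have hzeroD : ∀ α, α ∉ (S x₂' ∪ S x₂) ∪ (S x₁' ∪ S x₁) → sD α = 0 := by
    intro α hα
    simp only [Finset.mem_union, not_or] at hα
    simp only [hsDdef]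
    rw [hds0 x₂ x₂' α (fun ⟨y, hy⟩ => hα.1.1 (hS x₂' hdeep₂e α y hy)) (fun ⟨y, hy⟩ => hα.1.2 (hS x₂ hdeep₂ α y hy)),
      hds0 x₁ x₁' α (fun ⟨y, hy⟩ => hα.2.1 (hS x₁' hdeep₁e α y hy)) (fun ⟨y, hy⟩ => hα.2.2 (hS x₁ hdeep₁ α y hy))]
    simp only [mulVec_zero, Pi.zero_apply, mul_zero, sub_self]
  have hsumD : ‖∑ α, sD α‖ ≤ 4 * m * (P.eps⁻¹ * BD) := by
    rw [← Finset.sum_subset (Finset.subset_univ ((S x₂' ∪ S x₂) ∪ (S x₁' ∪ S x₁))) (fun α _ hα => hzeroD α hα)]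
    have hcardU : (((((S x₂' ∪ S x₂) ∪ (S x₁' ∪ S x₁)).card : ℕ)) : ℝ) ≤ 4 * m := by
      have h1 : ((((S x₂' ∪ S x₂) ∪ (S x₁' ∪ S x₁)).card : ℕ) : ℝ) ≤ (((S x₂' ∪ S x₂).card : ℕ) : ℝ) + (((S x₁' ∪ S x₁).card : ℕ) : ℝ) := by
        exact_mod_cast Finset.card_union_le _ _
      have h2 : (((S x₂' ∪ S x₂).card : ℕ) : ℝ) ≤ ((S x₂').card : ℝ) + ((S x₂).card : ℝ) := by exact_mod_cast Finset.card_union_le _ _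
      have h3 : (((S x₁' ∪ S x₁).card : ℕ) : ℝ) ≤ ((S x₁').card : ℝ) + ((S x₁).card : ℝ) := by exact_mod_cast Finset.card_union_le _ _
      linarith only [h1, h2, h3, hcard x₂', hcard x₂, hcard x₁', hcard x₁]
    calc ‖∑ α ∈ (S x₂' ∪ S x₂) ∪ (S x₁' ∪ S x₁), sD α‖ ≤ ∑ α ∈ (S x₂' ∪ S x₂) ∪ (S x₁' ∪ S x₁), ‖sD α‖ := norm_sum_le _ _
      _ ≤ ∑ α ∈ (S x₂' ∪ S x₂) ∪ (S x₁' ∪ S x₁), P.eps⁻¹ * BD := Finset.sum_le_sum fun α _ => htermD α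
      _ = ((S x₂' ∪ S x₂) ∪ (S x₁' ∪ S x₁)).card * (P.eps⁻¹ * BD) := by rw [Finset.sum_const, nsmul_eq_mul]
      _ ≤ 4 * m * (P.eps⁻¹ * BD) := mul_le_mul_of_nonneg_right hcardU (by positivity)
  /- ASSEMBLY -/
  have hscale : P.eps⁻¹ * P.spacing k ^ 2 = P.spacing k * (P.L : ℝ) ^ k := by
    rw [Params.spacing]
    field_simp
  have hspacing : P.eps * (P.L : ℝ) ^ k = P.spacing k := by rw [Params.spacing]; ring
  -- the Lipschitz moduli against the bracket: `L^k·Λ₁ ≤ Λ₀·br`, `(L^k)²·Λ₂ ≤ Λ₀₂·br²`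
  have hΛ₁le : (P.L : ℝ) ^ k * Λ₁ ≤ Λ₀ * br := by
    have h1 : Λ₁ ≤ Λ₀ * uv := by
      rw [hΛ₁def, huvdef, mul_add]
      refine add_le_add ?_ ?_
      · rw [div_eq_mul_inv]
        exact mul_le_mul_of_nonneg_right (le_max_left _ _) (inv_pos.mpr hgap').le
      · have e : 3 * Real.pi * (d + 1 : ℕ) / (2 * s) = (3 * Real.pi * (d + 1 : ℕ) / 2) * (s : ℝ)⁻¹ := by
          field_simp
        rw [e]
        exact mul_le_mul_of_nonneg_right (le_max_right _ _) (inv_pos.mpr hsr).le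
    calc (P.L : ℝ) ^ k * Λ₁ ≤ (P.L : ℝ) ^ k * (Λ₀ * uv) := mul_le_mul_of_nonneg_left h1 hLk.le
      _ = Λ₀ * ((P.L : ℝ) ^ k * uv) := by ring
      _ ≤ Λ₀ * br := mul_le_mul_of_nonneg_left hLuv hΛ₀0
  have hΛ₂le : ((P.L : ℝ) ^ k) ^ 2 * Λ₂ ≤ Λ₀₂ * br ^ 2 := by
    have hu : 0 ≤ (R₀ - R₁)⁻¹ := (inv_pos.mpr hgap').le
    have hv : 0 ≤ (s : ℝ)⁻¹ := (inv_pos.mpr hsr).le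
    have h1 : Λ₂ ≤ Λ₀₂ * uv ^ 2 := by
      rw [hΛ₂def, hΛ₀₂def, huvdef]
      have e1 : K₂ / (R₀ - R₁) ^ 2 = K₂ * ((R₀ - R₁)⁻¹) ^ 2 := by rw [div_eq_mul_inv, inv_pow]
      have e2 : 4 * Real.pi ^ 2 / (s : ℝ) ^ 2 = 4 * Real.pi ^ 2 * ((s : ℝ)⁻¹) ^ 2 := by rw [div_eq_mul_inv, inv_pow]
      have e3 : 2 * (K₁ / (R₀ - R₁) * (3 * Real.pi * (d + 1 : ℕ) / (2 * s))) =
          3 * Real.pi * (d + 1 : ℕ) * K₁ * ((R₀ - R₁)⁻¹ * (s : ℝ)⁻¹) := by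
        rw [div_eq_mul_inv, div_eq_mul_inv, mul_inv]
        ring
      rw [e1, e2, e3]
      have hK₂' : 0 ≤ K₂ := hK₂
      have hq1 : ((R₀ - R₁)⁻¹) ^ 2 ≤ ((R₀ - R₁)⁻¹ + (s : ℝ)⁻¹) ^ 2 := pow_le_pow_left₀ hu (le_add_of_nonneg_right hv) 2
      have hq2 : ((s : ℝ)⁻¹) ^ 2 ≤ ((R₀ - R₁)⁻¹ + (s : ℝ)⁻¹) ^ 2 := pow_le_pow_left₀ hv (le_add_of_nonneg_left hu) 2
      have hq3 : (R₀ - R₁)⁻¹ * (s : ℝ)⁻¹ ≤ ((R₀ - R₁)⁻¹ + (s : ℝ)⁻¹) ^ 2 := by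
        have e : ((R₀ - R₁)⁻¹ + (s : ℝ)⁻¹) ^ 2 =
            (R₀ - R₁)⁻¹ * (s : ℝ)⁻¹ + (((R₀ - R₁)⁻¹) ^ 2 + (R₀ - R₁)⁻¹ * (s : ℝ)⁻¹ + ((s : ℝ)⁻¹) ^ 2) := by ring
        rw [e]
        exact le_add_of_nonneg_right (by positivity)
      have hπ : 0 ≤ 4 * Real.pi ^ 2 := by positivity
      have hπK : 0 ≤ 3 * Real.pi * (d + 1 : ℕ) * K₁ := by positivity
      calc K₂ * ((R₀ - R₁)⁻¹) ^ 2 + 4 * Real.pi ^ 2 * ((s : ℝ)⁻¹) ^ 2 + 3 * Real.pi * (d + 1 : ℕ) * K₁ * ((R₀ - R₁)⁻¹ * (s : ℝ)⁻¹)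
          ≤ K₂ * ((R₀ - R₁)⁻¹ + (s : ℝ)⁻¹) ^ 2 + 4 * Real.pi ^ 2 * ((R₀ - R₁)⁻¹ + (s : ℝ)⁻¹) ^ 2 +
            3 * Real.pi * (d + 1 : ℕ) * K₁ * ((R₀ - R₁)⁻¹ + (s : ℝ)⁻¹) ^ 2 :=
            add_le_add (add_le_add (mul_le_mul_of_nonneg_left hq1 hK₂') (mul_le_mul_of_nonneg_left hq2 hπ))
              (mul_le_mul_of_nonneg_left hq3 hπK)
        _ = (K₂ + 4 * Real.pi ^ 2 + 3 * Real.pi * (d + 1 : ℕ) * K₁) * ((R₀ - R₁)⁻¹ + (s : ℝ)⁻¹) ^ 2 := by ring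
    calc ((P.L : ℝ) ^ k) ^ 2 * Λ₂ ≤ ((P.L : ℝ) ^ k) ^ 2 * (Λ₀₂ * uv ^ 2) := mul_le_mul_of_nonneg_left h1 (by positivity)
      _ = Λ₀₂ * ((P.L : ℝ) ^ k * uv) ^ 2 := by ring
      _ ≤ Λ₀₂ * br ^ 2 := mul_le_mul_of_nonneg_left (pow_le_pow_left₀ (by positivity) hLuv 2) hΛ₀₂0
  -- the four terms in the common shape `spacing·(C_T·m·br²·Ex·F)`
  have hA : w * ‖∑ α, sA α‖ ≤ P.spacing k * (cH * m * br ^ 2 * Ex * F) := by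
    refine hsumA.trans ?_
    rw [hBAdef]
    have h1 : cH * Real.exp (-(δH * (((P.L : ℝ) ^ k)⁻¹ * D))) * F ≤ cH * Ex * F :=
      mul_le_mul_of_nonneg_right (mul_le_mul_of_nonneg_left hEH hcH.le) hF0
    have h2 : 1 ≤ br ^ 2 := hbr1.trans hbr2
    calc m * (P.spacing k * (cH * Real.exp (-(δH * (((P.L : ℝ) ^ k)⁻¹ * D))) * F)) ≤ m * (P.spacing k * (cH * Ex * F)) :=
          mul_le_mul_of_nonneg_left (mul_le_mul_of_nonneg_left h1 hsp0.le) hm0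
      _ = P.spacing k * (cH * m * 1 * Ex * F) := by ring
      _ ≤ P.spacing k * (cH * m * br ^ 2 * Ex * F) := by
          refine mul_le_mul_of_nonneg_left ?_ hsp0.le
          exact mul_le_mul_of_nonneg_right (mul_le_mul_of_nonneg_right (mul_le_mul_of_nonneg_left h2 (by positivity)) hE0.le) hF0
  have hB : w * ‖∑ α, sB α‖ ≤ P.spacing k * (CB * m * br ^ 2 * Ex * F) := by
    have h1 : w * ‖∑ α, sB α‖ ≤ w * (2 * m * BB) := mul_le_mul_of_nonneg_left hsumB hw0
    refine h1.trans ?_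
    have e : w * (2 * m * BB) =
        (w * T12) * Λ₁ * (P.spacing k * (2 * ((d : ℝ) + 1) * c₁ * m * Real.exp (-(δ₁ * (((P.L : ℝ) ^ k)⁻¹ * D))) * F)) := by
      rw [hBBdef]; ring
    rw [e]
    have h2 : (w * T12) * Λ₁ ≤ Λ₀ * br :=
      le_trans (mul_le_mul_of_nonneg_right hwT hΛ₁0) hΛ₁le
    have h3 : P.spacing k * (2 * ((d : ℝ) + 1) * c₁ * m * Real.exp (-(δ₁ * (((P.L : ℝ) ^ k)⁻¹ * D))) * F) ≤
        P.spacing k * (2 * ((d : ℝ) + 1) * c₁ * m * Ex * F) :=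
      mul_le_mul_of_nonneg_left (mul_le_mul_of_nonneg_right (mul_le_mul_of_nonneg_left hE1 (by positivity)) hF0) hsp0.le
    calc (w * T12) * Λ₁ * (P.spacing k * (2 * ((d : ℝ) + 1) * c₁ * m * Real.exp (-(δ₁ * (((P.L : ℝ) ^ k)⁻¹ * D))) * F))
        ≤ (Λ₀ * br) * (P.spacing k * (2 * ((d : ℝ) + 1) * c₁ * m * Ex * F)) :=
          mul_le_mul h2 h3 (by positivity) (by positivity)
      _ = P.spacing k * (CB * m * br * Ex * F) := by rw [hCBdef]; ring
      _ ≤ P.spacing k * (CB * m * br ^ 2 * Ex * F) := by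
          refine mul_le_mul_of_nonneg_left ?_ hsp0.le
          exact mul_le_mul_of_nonneg_right (mul_le_mul_of_nonneg_right (mul_le_mul_of_nonneg_left hbr2 (mul_nonneg hCB0 hm0)) hE0.le) hF0
  have hC : w * ‖∑ α, sC α‖ ≤ P.spacing k * (CC * m * br ^ 2 * Ex * F) := by
    have h1 : w * ‖∑ α, sC α‖ ≤ w * (2 * m * (BC * (((d : ℝ) + 1) * T12))) := mul_le_mul_of_nonneg_left hsumC hw0
    refine h1.trans ?_
    have e : w * (2 * m * (BC * (((d : ℝ) + 1) * T12))) =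
        (w * T12) * Λ₁ * (P.spacing k * (2 * ((d : ℝ) + 1) * c₁ * m * Real.exp (-(δ₁ * (((P.L : ℝ) ^ k)⁻¹ * D'))) * F)) := by
      rw [hBCdef]; ring
    rw [e]
    have h2 : (w * T12) * Λ₁ ≤ Λ₀ * br :=
      le_trans (mul_le_mul_of_nonneg_right hwT hΛ₁0) hΛ₁le
    have h3 : P.spacing k * (2 * ((d : ℝ) + 1) * c₁ * m * Real.exp (-(δ₁ * (((P.L : ℝ) ^ k)⁻¹ * D'))) * F) ≤
        P.spacing k * (2 * ((d : ℝ) + 1) * c₁ * m * (Real.exp δ₁ * Ex) * F) :=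
      mul_le_mul_of_nonneg_left (mul_le_mul_of_nonneg_right (mul_le_mul_of_nonneg_left hexpD' (by positivity)) hF0) hsp0.le
    calc (w * T12) * Λ₁ * (P.spacing k * (2 * ((d : ℝ) + 1) * c₁ * m * Real.exp (-(δ₁ * (((P.L : ℝ) ^ k)⁻¹ * D'))) * F))
        ≤ (Λ₀ * br) * (P.spacing k * (2 * ((d : ℝ) + 1) * c₁ * m * (Real.exp δ₁ * Ex) * F)) :=
          mul_le_mul h2 h3 (by positivity) (by positivity)
      _ = P.spacing k * (CC * m * br * Ex * F) := by rw [hCCdef]; ring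
      _ ≤ P.spacing k * (CC * m * br ^ 2 * Ex * F) := by
          refine mul_le_mul_of_nonneg_left ?_ hsp0.le
          exact mul_le_mul_of_nonneg_right (mul_le_mul_of_nonneg_right (mul_le_mul_of_nonneg_left hbr2 (mul_nonneg hCC0 hm0)) hE0.le) hF0
  have hDt : w * ‖∑ α, sD α‖ ≤ P.spacing k * (CD * m * br ^ 2 * Ex * F) := by
    have h1 : w * ‖∑ α, sD α‖ ≤ w * (4 * m * (P.eps⁻¹ * BD)) := mul_le_mul_of_nonneg_left hsumD hw0
    refine h1.trans ?_
    have e : w * (4 * m * (P.eps⁻¹ * BD)) =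
        (w * T12) * ((P.eps⁻¹ * P.spacing k ^ 2) * (4 * ((d : ℝ) + 1) * c₂ * m * Λ₂ * Real.exp (-(δ₂ * (((P.L : ℝ) ^ k)⁻¹ * D))) * F)) := by
      rw [hBDdef]; ring
    rw [e, hscale]
    have e2 : (w * T12) * (P.spacing k * (P.L : ℝ) ^ k * (4 * ((d : ℝ) + 1) * c₂ * m * Λ₂ * Real.exp (-(δ₂ * (((P.L : ℝ) ^ k)⁻¹ * D))) * F)) =
        ((w * T12) * ((P.L : ℝ) ^ k * Λ₂)) * (P.spacing k * (4 * ((d : ℝ) + 1) * c₂ * m * Real.exp (-(δ₂ * (((P.L : ℝ) ^ k)⁻¹ * D))) * F)) := by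
      ring
    rw [e2]
    have h2 : (w * T12) * ((P.L : ℝ) ^ k * Λ₂) ≤ Λ₀₂ * br ^ 2 := by
      calc (w * T12) * ((P.L : ℝ) ^ k * Λ₂) ≤ (P.L : ℝ) ^ k * ((P.L : ℝ) ^ k * Λ₂) := mul_le_mul_of_nonneg_right hwT (by positivity)
        _ = ((P.L : ℝ) ^ k) ^ 2 * Λ₂ := by ring
        _ ≤ Λ₀₂ * br ^ 2 := hΛ₂le
    have h3 : P.spacing k * (4 * ((d : ℝ) + 1) * c₂ * m * Real.exp (-(δ₂ * (((P.L : ℝ) ^ k)⁻¹ * D))) * F) ≤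
        P.spacing k * (4 * ((d : ℝ) + 1) * c₂ * m * Ex * F) :=
      mul_le_mul_of_nonneg_left (mul_le_mul_of_nonneg_right (mul_le_mul_of_nonneg_left hE2 (by positivity)) hF0) hsp0.le
    calc ((w * T12) * ((P.L : ℝ) ^ k * Λ₂)) * (P.spacing k * (4 * ((d : ℝ) + 1) * c₂ * m * Real.exp (-(δ₂ * (((P.L : ℝ) ^ k)⁻¹ * D))) * F))
        ≤ (Λ₀₂ * br ^ 2) * (P.spacing k * (4 * ((d : ℝ) + 1) * c₂ * m * Ex * F)) :=
          mul_le_mul h2 h3 (by positivity) (by positivity)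
      _ = P.spacing k * (CD * m * br ^ 2 * Ex * F) := by rw [hCDdef]; ring
  -- conclusion
  have hsplit : ‖(∑ α, sA α + ∑ α, sB α) + (∑ α, sC α + ∑ α, sD α)‖ ≤
      ‖∑ α, sA α‖ + ‖∑ α, sB α‖ + (‖∑ α, sC α‖ + ‖∑ α, sD α‖) :=
    (norm_add_le _ _).trans (add_le_add (norm_add_le _ _) (norm_add_le _ _))
  have hCsum : cH + CB + CC + CD ≤ C := by rw [hCdef]; linarith only [hcg.le]
  calc w * ‖τ * (∑ α, covD P.eps⁻¹ (cfg U) (G α *ᵥ gs x₂' α) ⟨x₂, μ⟩ + ∑ α, Ec * (G α *ᵥ ds x₂ x₂' α) x₂) -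
        (∑ α, covD P.eps⁻¹ (cfg U) (G α *ᵥ gs x₁' α) ⟨x₁, μ⟩ + ∑ α, Ec * (G α *ᵥ ds x₁ x₁' α) x₁)‖
      = w * ‖(∑ α, sA α + ∑ α, sB α) + (∑ α, sC α + ∑ α, sD α)‖ := by rw [hdecomp]
    _ ≤ w * (‖∑ α, sA α‖ + ‖∑ α, sB α‖ + (‖∑ α, sC α‖ + ‖∑ α, sD α‖)) := mul_le_mul_of_nonneg_left hsplit hw0
    _ = w * ‖∑ α, sA α‖ + w * ‖∑ α, sB α‖ + (w * ‖∑ α, sC α‖ + w * ‖∑ α, sD α‖) := by ring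
    _ ≤ P.spacing k * (cH * m * br ^ 2 * Ex * F) + P.spacing k * (CB * m * br ^ 2 * Ex * F) +
          (P.spacing k * (CC * m * br ^ 2 * Ex * F) + P.spacing k * (CD * m * br ^ 2 * Ex * F)) :=
        add_le_add (add_le_add hA hB) (add_le_add hC hDt)
    _ = P.spacing k * ((cH + CB + CC + CD) * m * br ^ 2 * Ex * F) := by ring
    _ ≤ P.spacing k * (C * m * br ^ 2 * Ex * F) := by
        refine mul_le_mul_of_nonneg_left ?_ hsp0.le
        exact mul_le_mul_of_nonneg_right (mul_le_mul_of_nonneg_right (mul_le_mul_of_nonneg_right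
          (mul_le_mul_of_nonneg_right hCsum hm0) (by positivity)) hE0.le) hF0

end DerivHolder

/-! ## §5 The member for the smooth product cut-off `ζ″ = ζ^Π(R₁, R₀)` of (2.29) -/

section ZetaPiMember

/-- **THE HÖLDER MEMBER OF ORDER `1 + θ` OF (2.30) AT `u = 1^h` FOR `G_{k,loc}` BUILT FROM THE TORUS CUBES AND WEIGHTS OF RECORD AND THE
SMOOTH PRODUCT CUT-OFF `ζ″ = ζ^Π(R₁, R₀)`** (print p. 263: *"ζ_k(x₁, x₂) is a smooth function of x₁ − x₂"*, *"Bounds analogous to (2.30) …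
hold for … Holder derivatives of G_{k,loc}(u) of order less than two"*): for every `0 ≤ θ < 1` THERE EXIST `δ₀, c₀ > 0` depending on
`(d, ℓ, a, θ)` and the universal profile bound `C_σ` only such that, for all data as in `derivHolder230_flat_of_smooth` with `1 ≤ R₁ < R₀ ≤
(|T^{(0)}| − 3)/2`,
`(L^k/|x₁ − x₂|_T)^θ·‖h(x₁)h(x₂)⁻¹(D_uG_{k,loc}(1^h)f)(x₂, μ) − (D_uG_{k,loc}(1^h)f)(x₁, μ)‖ ≤ (L^kε)·c₀·m·(1 + L^k((R₀ − R₁)⁻¹ + s⁻¹))²·e^{−δ₀D/L^k}·F`.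
[cite: BalabanImbrieJaffe1988, (2.30) p.263] -/
theorem derivHolder230_flat_zetaPi (d ℓ : ℕ) (hℓ : 1 ≤ ℓ) {a : ℝ} (ha : 0 < a) {θ : ℝ} (hθ0 : 0 ≤ θ) (hθ1 : θ < 1) :
    ∃ δ₀ c₀ : ℝ, 0 < δ₀ ∧ 0 < c₀ ∧ ∀ (P : Params) (hPd : P.d = d + 1), P.L = ℓ + 1 →
      ∀ k : ℕ, 1 ≤ k → k ≤ P.K → ∀ (c M0 : Fin (d + 1) → ℕ), (∀ i, 1 ≤ M0 i) →
        (∀ i, c i * P.L ^ k + P.L ^ k * M0 i ≤ P.sitesPerDir 0) → (∀ i, 2 * (P.L ^ k * M0 i) ≤ P.sitesPerDir 0) →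
      ∀ (s W : ℕ), 1 ≤ s → ∀ (R R₀ R₁ : ℝ), (P.L : ℝ) ^ k + 2 < R → 1 ≤ R₁ → R₁ < R₀ → R₀ ≤ ((P.sitesPerDir 0 : ℝ) - 3) / 2 →
        2 * (s : ℝ) / 3 + R₀ / 2 + R ≤ W → (∀ i, ((P.L ^ k * M0 i : ℕ) : ℝ) + R ≤ P.sitesPerDir 0) → (P.L : ℝ) ^ k ≤ R₀ →
      ∀ (h : GaugeTransf P 0 U1) (x₁ x₂ : Balaban1983to89.Site P 0) (μ : Fin P.d),
        x₁ ∈ (cubeT hPd (P.L ^ k) c fun i => P.L ^ k * M0 i) →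
        (∀ i, R₀ ≤ (boxCoord hPd (P.L ^ k) c x₁ i : ℝ) ∧ (boxCoord hPd (P.L ^ k) c x₁ i : ℝ) + R₀ ≤ (P.L ^ k * M0 i : ℕ) - 1) →
        x₁.shift μ ∈ (cubeT hPd (P.L ^ k) c fun i => P.L ^ k * M0 i) →
        (∀ i, R₀ ≤ (boxCoord hPd (P.L ^ k) c (x₁.shift μ) i : ℝ) ∧
          (boxCoord hPd (P.L ^ k) c (x₁.shift μ) i : ℝ) + R₀ ≤ (P.L ^ k * M0 i : ℕ) - 1) →
        x₂ ∈ (cubeT hPd (P.L ^ k) c fun i => P.L ^ k * M0 i) →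
        (∀ i, R₀ ≤ (boxCoord hPd (P.L ^ k) c x₂ i : ℝ) ∧ (boxCoord hPd (P.L ^ k) c x₂ i : ℝ) + R₀ ≤ (P.L ^ k * M0 i : ℕ) - 1) →
        x₂.shift μ ∈ (cubeT hPd (P.L ^ k) c fun i => P.L ^ k * M0 i) →
        (∀ i, R₀ ≤ (boxCoord hPd (P.L ^ k) c (x₂.shift μ) i : ℝ) ∧
          (boxCoord hPd (P.L ^ k) c (x₂.shift μ) i : ℝ) + R₀ ≤ (P.L ^ k * M0 i : ℕ) - 1) →
      ∀ (f : Balaban1983to89.Site P 0 → ℂ) (F D : ℝ), (∀ y, ‖f y‖ ≤ F) → 0 ≤ D →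
        (∀ y, f y ≠ 0 → D ≤ B5Ineq137Torus.T P 0 x₁ y) → (∀ y, f y ≠ 0 → D ≤ B5Ineq137Torus.T P 0 x₂ y) →
        ((P.L : ℝ) ^ k / B5Ineq137Torus.T P 0 x₁ x₂) ^ θ *
          ‖toC (h x₁) * (toC (h x₂))⁻¹ *
              covD P.eps⁻¹ (cfg (gaugeAct h (1 : GaugeField P 0 U1)))
                (gLocT (B1RG242Torus.α P a k * (P.L : ℝ) ^ (k * P.d)) P.eps⁻¹ (gaugeAct h (1 : GaugeField P 0 U1)) k
                  (cubeFam hPd (P.L ^ k) c M0 s W) (lamFam hPd (P.L ^ k) c M0 s) (zetaPi R₁ R₀ 0) *ᵥ f) ⟨x₂, μ⟩ -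
            covD P.eps⁻¹ (cfg (gaugeAct h (1 : GaugeField P 0 U1)))
                (gLocT (B1RG242Torus.α P a k * (P.L : ℝ) ^ (k * P.d)) P.eps⁻¹ (gaugeAct h (1 : GaugeField P 0 U1)) k
                  (cubeFam hPd (P.L ^ k) c M0 s W) (lamFam hPd (P.L ^ k) c M0 s) (zetaPi R₁ R₀ 0) *ᵥ f) ⟨x₁, μ⟩‖ ≤
          P.spacing k * (c₀ * (⌊(((P.L : ℝ) ^ k) - 1 + R₀) / s⌋₊ + 3) ^ (d + 1) *
            (1 + (P.L : ℝ) ^ k * ((R₀ - R₁)⁻¹ + (s : ℝ)⁻¹)) ^ 2 * Real.exp (-(δ₀ * (((P.L : ℝ) ^ k)⁻¹ * D))) * F) := by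
  obtain ⟨C, hC0, hC1, hC2⟩ := exists_abs_deriv_and_deriv_deriv_smoothTransition_le
  have hK₂ : 0 ≤ C ^ 2 + C := by positivity
  obtain ⟨δ₀, c₀, hδ₀, hc₀, H⟩ := derivHolder230_flat_of_smooth d ℓ hℓ ha hθ0 hθ1 hC0 hK₂
  refine ⟨δ₀, c₀, hδ₀, hc₀, ?_⟩
  intro P hPd hPL k hk1 hkK c M0 hM0 hfit0 hhalf s W hs R R₀ R₁ hR hR₁ hR10 hR₀N hW hgap hLR₀ h x₁ x₂ μ hx₁ hdeep₁ hx₁e hdeep₁e hx₂ hdeep₂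
    hx₂e hdeep₂e f F D hF hD hsupp₁ hsupp₂
  have e : secondDiffConst C R₁ R₀ = (C ^ 2 + C) / (R₀ - R₁) ^ 2 := by rw [secondDiffConst, div_pow, add_div]
  exact H P hPd hPL k hk1 hkK c M0 hM0 hfit0 hhalf s W hs R R₀ R₁ hR (zero_le_one.trans hR₁) hR10 hW hgap hLR₀ (zetaPi R₁ R₀ 0)
    (abs_zetaPi_zero_le_one R₁ R₀) (zetaPi_zero_eq_zero_of_le hR10) (abs_zetaPi_zero_shift_sub_le hC1 hR10)
    (fun x y κ ν => (abs_zetaPi_zero_secondDiff_le hC1 hC2 hR10 hR₁ hR₀N x y κ ν).trans_eq e)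
    h x₁ x₂ μ hx₁ hdeep₁ hx₁e hdeep₁e hx₂ hdeep₂ hx₂e hdeep₂e f F D hF hD hsupp₁ hsupp₂

end ZetaPiMember

end

end Literature.MathematicalPhysics.QuantumFieldTheory.BalabanImbrieJaffe1984to88.BIJ88LocDerivHolder230FlatTorus
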